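import Literature.Analysis.FluidPDE.GigaMiura2011UnidirectionalVorticityHolds
import Literature.Analysis.FluidPDE.AncientMildCompactness
import Literature.Analysis.FluidPDE.KNSSMildBootstrapStep
import Literature.Analysis.FluidPDE.KNSSProp41MildHolds
import Literature.Analysis.FluidPDE.NSBoundedMildSmoothing
import Literature.Analysis.FluidPDE.NSLerayOseenRepresentation
import Literature.Analysis.FluidPDE.NSBoundedMildOseenRestart
import Literature.Analysis.FluidPDE.KNSSTypeIRateMildBridge
import Literature.Analysis.FluidPDE.KNSSTypeIRateMildProofs
import Literature.Analysis.FluidPDE.NSLerayBlowupRateTopHolds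
import Literature.Analysis.FluidPDE.LerayHopfRestartEverywhere
import Literature.Analysis.FluidPDE.ClassicalSolutionGlue
import Literature.Analysis.FluidPDE.ClassicalSolutionRescale
import Literature.Analysis.FluidPDE.DirectionDissipation
import Literature.Analysis.FluidPDE.TaoQuantitativeTotalSpeed
import Literature.Analysis.FluidPDE.SpaceTimeCalculusC1
import Literature.Analysis.Calculus.DerivativeInterpolation
import Literature.Analysis.FunctionSpaces.ContDiffHolderOne
import HarnessLib

/-!
# Giga–Miura 2011, Proposition 2.2 as printed (the (CA′) blow-up limit has zero vorticity) —
# the named fact `gigaMiura2011_scaledAlignment_blowupLimit_curl_eq_zero` discharged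

Analysis/FluidPDE proof file (everything proved; no definitions, no named facts), sibling of
`GigaMiura2011BlowupAnalysis.lean`, discharging its named fact
`Literature.Analysis.FluidPDE.gigaMiura2011_scaledAlignment_blowupLimit_curl_eq_zero` (Y. Giga,
H. Miura, *On vorticity directions near singularities for the Navier–Stokes flows with infinite
energy*, Comm. Math. Phys. **303** (2011) 289–300 = Hokkaido Univ. Preprint **#956**, §2.1,
**Proposition 2.2**, p. 7: "Assume that `u` is a mild solution of (NS) in `ℝ³ × (−1, 0)` which is
bounded in `ℝ³ × (−1, −δ)` for all `δ > 0`. If `ζ` satisfies (CA′), then `ω = 0`", `ω` the vorticity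
of the blow-up limit of the near-maximum rescaling of p. 5). In the statement file's rendering: a
classical solution `(u, p)` of viscosity `ν` on `ℝ³ × [0, T)`, Leray–Hopf from `u 0`, bounded on every
closed sub-strip, with (CA′) = `HasScaledContinuousAlignment ν T u`; the near-maximum sequence of p. 5
(`t_k → T`, levels `M_k → ∞` bounding `|u|` on `[0, t_k] × ℝ³` and attained up to `1` at
`(t_k, x_k)`), scales `λ_k = ν/M_k`; conclusion: EVERY pointwise limit `Ω` on `s ≤ 0` of the rescaled
vorticities `(λ_k²/ν) ω(t_k + λ_k²s/ν, x_k + λ_k y)` vanishes. No Type I hypothesis.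

## The printed proof and how it is followed

Print (HUPS #956 p. 5 and p. 7): "(`u_k`, `p_k`) is also the solution of (1.1) … (`u_k`, `ω_k`)
subsequently converges to some (`ū`, `ω̄`) locally uniformly in `ℝ³ × (−∞, 0)` with its derivatives by
(2.1) … By (CA′) we see that `|ζ_k(x,t) − ζ_k(y,t)| ≤ η(o(1)|x − y|/√(−t))` … Sending `k → ∞` …
`ω(x,t) = |ω(x,t)| ζ₀(t)` … [2D reduction, Lemma 2.3] … `ω ≡ 0`." The steps:

1. *The zooms are unit-viscosity mild solutions with uniform bounds* (§Z): `u_k = (λ_k/ν) u ∘ Φ_k`,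
   `Φ_k(s, y) = (t_k + λ_k²s/ν, x_k + λ_k y)`, is a classical solution of (1.1) with `ν = 1` on the
   window `(−t_kM_k²/ν, (T − t_k)M_k²/ν)` (Leray's similarity, `IsClassicalNSSolutionOn.stRescale`),
   satisfies the Oseen integral equation there (`zoom_oseen_window`: Lemarié-Rieusset 2016 Thm 6.1
   for the Leray–Hopf solution, `ae_eq_heatExtension_sub_oseenDuhamel_of_isMildNSSolutionOn`,
   restarted by `oseenMild_restart_holds`, transported by `oseen_smul_stPull`), and `|u_k| ≤ 1` for
   `s ≤ 0` by the choice of `M_k`. Two inputs not spelled out in print make the window uniform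
   BEYOND `s = 0` (needed because the fact quantifies the limit at `s = 0` too): Leray's rate
   `M_k ≥ c√ν/√(T − t_k)` at the near-maximum levels (§L, `exists_lerayRate_point_of_unbounded` —
   Leray 1934 §19 (3.9), here WITHOUT a maximality hypothesis, from unboundedness alone) makes the
   right end `(T − t_k)M_k²/ν ≥ c²` uniform, and Leray's (3.15) (`exists_norm_le_two_mul_after`,
   Ożański–Pooley Lemma 6.23 (i)) gives `|u_k| ≤ 2` on `(−t_kM_k²/ν, 2B)` for a universal `B > 0`.
2. *Compactness with derivatives* (§W, §C): after the time shift `s ↦ s + B`, KNSS 2009 Lemma 6.1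
   (`KNSS2009_lemma61_oseenMild`) extracts a subsequence converging locally uniformly on the open slab
   to a bounded ancient Oseen-mild field `ū`; KNSS §4 (Prop. 4.1, (4.10): `KNSS2009_prop41_mild_holds`,
   `KNSSBootstrap.exists_norm_iteratedFDeriv_slice_le`, through the bounded-window lemma
   `isKNSSDriftMild_window_of_bounded`) bounds all spatial derivatives uniformly on windows, so
   Landau's interpolation (`Calculus.tendsto_iteratedFDeriv_of_tendsto`) upgrades the convergence
   to the gradients and the vorticities (`tendsto_curl_of_bounded_oseenMild`) — the printed "with its
   derivatives by (2.1)".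
3. *(CA′) along the zoom* (§D, `dir_eq_of_scaledAlignment_lerayZoom`): at two points where the limit
   vorticity is non-zero the physical vorticities exceed the level `d` eventually, the physical
   distance is `λ_k|y − y'|`, and `λ_k ≤ (√2/c)√(ν(T − t))` by Leray's rate, so (CA′) bounds the chord
   of the directions by `η(θ(t)·(√2/c)|y − y'|) → η(0) = 0`: `curl ū(s) = |curl ū(s)| ζ₀(s)`.
4. *Rigidity* (§E): `ū` is smooth with all derivatives bounded
   (`smooth_and_bounds_of_bounded_ancient_oseenMild`), weakly divergence free and Oseen-mild, so
   the proved core of Proposition 2.2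
   (`gigaMiura2011_unidirectional_vorticity_eq_zero_holds`: the flow is two-dimensional, Lemma 2.3 /
   [KNSS] Thm 5.1) gives `curl ū ≡ 0`; and `Ω(s, ·)`, being the limit along the whole sequence, is
   the limit `curl ū(s − B + B) = curl ū` along the subsequence: `Ω ≡ 0` on `s ≤ 0`.

## Mathlib / tree search

Tree (all proved): `exists_norm_le_two_mul_of_window` (`NSLerayBlowupRateTopHolds`),
`IsLerayHopfOn.isLerayHopfOn_translate_of_bound` (`LerayHopfRestartEverywhere`),
`IsClassicalNSSolutionOn.translate_Ico_zero` (`ClassicalSolutionGlue`), `IsKNSSDriftMild`,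
`driftDuhamel_zero_eq_oseenDuhamel`, `oseenDuhamel_translate`, `oseenDuhamel_congr_Ioo`,
`KNSS2009_prop41_mild_holds`, `KNSSBootstrap.exists_norm_iteratedFDeriv_slice_le`,
`KNSS2009_lemma61_oseenMild` (`AncientMildCompactness`), `stPull`, `IsClassicalNSSolutionOn.stRescale`,
`timeRescale`, `oseenDuhamel_one_timeRescale`, `oseen_smul_stPull`, `curl_smul_stPull`,
`isMildNSSolutionOn_of_isLerayHopfOn_holds`, `oseenMild_restart_holds`, `continuous_oseenDuhamel_slice`,
`Calculus.tendsto_iteratedFDeriv_of_tendsto` (`Calculus/DerivativeInterpolation`),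
`contDiff_slice_of_contDiffOn`, `curl_eq_curlCLM`, `vorticityDirection_apply`,
`gigaMiura2011_unidirectional_vorticity_eq_zero_holds`. The window, zoom and (CA′)-passage lemmas are
Literature twins (bounded instead of Type I; centre `t_k < T` instead of `T`; Leray's rate instead of
the parabolic law) of the Summits-side `SqueezeCycleSingularZoomWindow`,
`ScaledTopAlignmentTypeIZoomNonAlignedLimitOseenSlab`, `dir_eq_of_scaledAlignment_zoom`, which
Literature cannot import. Mathlib: `Filter.Tendsto.pos_mul_atTop`, `tendsto_add_atTop_iff_nat`,
`continuousMultilinearCurryFin1`, `pow_le_pow_iff_left₀`.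

## References

* Y. Giga, H. Miura, Comm. Math. Phys. 303 (2011) 289–300 = Hokkaido Univ. Preprint #956 (2010),
  §2.1: the blow-up sequence (p. 5), Prop. 2.2 and its proof (pp. 7–8). [GigaMiura2011]
* G. Koch, N. Nadirashvili, G. Seregin, V. Šverák, Acta Math. 203 (2009) 83–105 =
  arXiv:0709.3599: §1 (1.1)–(1.2), §4 (i), Prop. 4.1, (4.10) (p. 8), Lemma 6.1 (p. 11), proof of
  Thm 6.2 (p. 13). [KochNadirashviliSereginSverak2009]
* J. Leray, Acta Math. 63 (1934): §19 (3.9) p. 224, §20, §21 (3.14)–(3.16) p. 226. [Leray1934]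
* W. S. Ożański, B. C. Pooley, in *Partial Differential Equations in Fluid Mechanics*, LMS Lecture
  Notes 452 (2018) = arXiv:1708.09787: Lemma 6.23 (i), Cor. 6.25. [OzanskiPooley2018]
* P. G. Lemarié-Rieusset, *The Navier–Stokes Problem in the 21st Century* (2016), Thm. 6.1,
  Prop. 6.5. [LemarieRieusset2016]
-/

noncomputable section

open MeasureTheory Set Function Filter TopologicalSpace Metric
open _root_.Topology
open scoped RealInnerProductSpace NNReal ENNReal

namespace Literature.Analysis.FluidPDE

/-! ### §L. Leray's rate at the points of a near-maximum sequence (no maximality hypothesis) -/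

section Leray

variable {ν T : ℝ} {u : ℝ → EuclideanSpace ℝ (Fin 3) → EuclideanSpace ℝ (Fin 3)}
  {p : ℝ → EuclideanSpace ℝ (Fin 3) → ℝ}

/-- **Leray's (3.15): a bounded classical Leray–Hopf solution at most doubles on a short window**
(Leray 1934, §21 (3.14)–(3.15), p. 226; Ożański–Pooley 2018, Lemma 6.23 (i): "`‖u(t)‖_∞ ≤ C‖u₀‖_∞`
for `t ≤ C/‖u₀‖²_∞`"), restarted at an interior time: there is a universal `C₁ > 0` such that for a
classical solution on `ℝ³ × [0, T)` of viscosity `ν > 0`, Leray–Hopf from `u 0`, bounded on every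
closed sub-strip `[0, T₁] × ℝ³` (`T₁ < T`), every `t₀ ∈ [0, T)` and every level `V₀ > 0` with
`‖u(t₀, ·)‖ ≤ V₀`: `‖u(t, x)‖ ≤ 2V₀` for all `t ∈ [t₀, T)` with `64 C₁² V₀² (t − t₀) < ν`
(the tree's `exists_norm_le_two_mul_of_window` applied to the translate `u(· + t₀)`, which is
Leray–Hopf from `u(t₀)` by `IsLerayHopfOn.isLerayHopfOn_translate_of_bound`).
[cite: Leray1934, §21 (3.14)–(3.15) p. 226] [cite: OzanskiPooley2018, Lemma 6.23 (i)] -/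
theorem exists_norm_le_two_mul_after :
    ∃ C₁ : ℝ, 0 < C₁ ∧ ∀ {ν T : ℝ} {u : ℝ → EuclideanSpace ℝ (Fin 3) → EuclideanSpace ℝ (Fin 3)}
      {p : ℝ → EuclideanSpace ℝ (Fin 3) → ℝ}, 0 < ν → 0 < T →
      IsClassicalNSSolutionOn (Ico 0 T) ν 0 u p → IsLerayHopfOn T ν 0 (u 0) u →
      (∀ T₁ ∈ Ioo 0 T, ∃ M : ℝ, ∀ t ∈ Icc 0 T₁, ∀ x, ‖u t x‖ ≤ M) →
      ∀ {t₀ V₀ : ℝ}, t₀ ∈ Ico 0 T → 0 < V₀ → (∀ y, ‖u t₀ y‖ ≤ V₀) →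
      ∀ t ∈ Ico t₀ T, 64 * C₁ ^ 2 * V₀ ^ 2 * (t - t₀) < ν → ∀ x, ‖u t x‖ ≤ 2 * V₀ := by
  obtain ⟨C₁, hC₁, hapr⟩ := exists_norm_le_two_mul_of_window
  refine ⟨C₁, hC₁, ?_⟩
  intro ν T u p hν hT hcl hLH hbdd t₀ V₀ ht₀ hV₀ hu₀ t ht hwin x
  rcases ht.1.eq_or_lt with h | htt
  · rw [← h]
    exact (hu₀ x).trans (by linarith)
  · -- the translate by `t₀` on the closed strip `[0, T₁]`, `s = t - t₀ < T₁ < T - t₀`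
    set s : ℝ := t - t₀ with hs
    have hs0 : 0 < s := sub_pos.2 htt
    have hsT : s < T - t₀ := by rw [hs]; linarith [ht.2]
    set T₁ : ℝ := (s + (T - t₀)) / 2 with hT₁
    have hsT₁ : s < T₁ := by rw [hT₁]; linarith
    have hT₁T : T₁ < T - t₀ := by rw [hT₁]; linarith
    have hT₁pos : 0 < T₁ := hs0.trans hsT₁
    have hT₁t₀ : T₁ + t₀ ∈ Ioo 0 T := ⟨by linarith [ht₀.1], by linarith⟩
    obtain ⟨M₀, hM₀⟩ := hbdd (T₁ + t₀) hT₁t₀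
    set M : ℝ := max M₀ 1 with hM
    have hMpos : 0 < M := lt_max_of_lt_right one_pos
    set w : ℝ → EuclideanSpace ℝ (Fin 3) → EuclideanSpace ℝ (Fin 3) := fun τ => u (τ + t₀) with hw
    set q : ℝ → EuclideanSpace ℝ (Fin 3) → ℝ := fun τ => p (τ + t₀) with hq
    have hw0 : w 0 = u t₀ := by
      show u (0 + t₀) = u t₀
      rw [zero_add]
    have hwcl : IsClassicalNSSolutionOn (Ico 0 (T - t₀)) ν 0 w q := hcl.translate_Ico_zero ht₀.1
    have hwcl₁ : IsClassicalNSSolutionOn (Icc 0 T₁) ν 0 w q :=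
      hwcl.mono (Icc_subset_Ico_right hT₁T) (uniqueDiffOn_Icc hT₁pos)
    have hMb : ∀ τ ∈ Icc 0 T₁, ∀ y, ‖w τ y‖ ≤ M := fun τ hτ y =>
      (hM₀ (τ + t₀) ⟨by linarith [hτ.1, ht₀.1], by linarith [hτ.2]⟩ y).trans (le_max_left _ _)
    -- Leray–Hopf from `u t₀` on `[0, T₁]`
    have hwLH : IsLerayHopfOn T₁ ν 0 (w 0) w := by
      rw [hw0]
      rcases ht₀.1.eq_or_lt with h0 | ht₀pos
      · have h1 : IsLerayHopfOn T₁ ν 0 (u 0) u := IsLerayHopfOn.mono_holds hLH (by linarith)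
        have hwu : w = u := by
          funext τ
          show u (τ + t₀) = u τ
          rw [← h0, add_zero]
        rw [hwu, ← h0]
        exact h1
      · have hLH'' : IsLerayHopfOn (T₁ + t₀) ν 0 (u 0) u :=
          IsLerayHopfOn.mono_holds hLH hT₁t₀.2.le
        have hcl'' : IsClassicalNSSolutionOn (Ico 0 (T₁ + t₀)) ν 0 u p :=
          hcl.mono (Ico_subset_Ico_right hT₁t₀.2.le) (uniqueDiffOn_Ico 0 (T₁ + t₀))
        have h1 := IsLerayHopfOn.isLerayHopfOn_translate_of_bound hν hT₁t₀.1 hLH''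
          (hLH.memLp 0 ⟨le_rfl, hT.le⟩) hcl'' hM₀ ⟨ht₀pos, by linarith⟩
        rwa [add_sub_cancel_right] at h1
    have hu₀b' : ∀ y, ‖w 0 y‖ ≤ V₀ := by
      rw [hw0]
      exact hu₀
    have h := hapr hν hT₁pos hwcl₁ hwLH hMpos hMb hV₀ hu₀b' s ⟨hs0, hsT₁.le⟩ hwin x
    have hws : w s x = u t x := by
      show u (s + t₀) x = u t x
      rw [hs, sub_add_cancel]
    rw [hws] at h
    exact h

/-- **Leray's lower bound on the maximum velocity before a blow-up time, maximality-free form**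
(Leray 1934, §19 (3.9), p. 224: "Si une solution des équations de Navier devient irrégulière à
l'époque `T`, alors `V(t) > A√(ν/(T − t))`"; §21 (3.14)–(3.16); Ożański–Pooley 2018, Cor. 6.25):
there is a universal `c > 0` such that for a classical solution on `ℝ³ × [0, T)` of viscosity
`ν > 0`, Leray–Hopf from `u 0`, bounded on every closed sub-strip but UNBOUNDED on `[0, T) × ℝ³`,
at every `t ∈ [0, T)` some point `x` has `‖u(t, x)‖ ≥ c√ν/√(T − t)`. (The tree's
`leray_blowup_rate_top_holds` states this for maximal solutions; here "irrégulière à l'époque `T`"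
is taken in Leray's own sense "`V(t)` augmente indéfiniment", which is what a near-maximum
blow-up sequence provides. Proof: otherwise `‖u(t, ·)‖ ≤ V₀ = c√ν/√(T − t)` and Leray's window
`64C₁²V₀²(T − t) < ν` covers `[t, T)`, so `exists_norm_le_two_mul_after` bounds `u` by `2V₀` on
`[t, T) × ℝ³`, and by hypothesis on `[0, t] × ℝ³`.) [cite: Leray1934, §19 (3.9) p. 224; §21 (3.14)–(3.16) p. 226] [cite: OzanskiPooley2018, Cor. 6.25 with Lemma 6.23 (i)] -/
theorem exists_lerayRate_point_of_unbounded :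
    ∃ c : ℝ, 0 < c ∧ ∀ {ν T : ℝ} {u : ℝ → EuclideanSpace ℝ (Fin 3) → EuclideanSpace ℝ (Fin 3)}
      {p : ℝ → EuclideanSpace ℝ (Fin 3) → ℝ}, 0 < ν → 0 < T →
      IsClassicalNSSolutionOn (Ico 0 T) ν 0 u p → IsLerayHopfOn T ν 0 (u 0) u →
      (∀ T₁ ∈ Ioo 0 T, ∃ M : ℝ, ∀ t ∈ Icc 0 T₁, ∀ x, ‖u t x‖ ≤ M) →
      (¬ ∃ M : ℝ, ∀ t ∈ Ico 0 T, ∀ x, ‖u t x‖ ≤ M) →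
      ∀ t ∈ Ico 0 T, ∃ x, c * Real.sqrt ν / Real.sqrt (T - t) ≤ ‖u t x‖ := by
  obtain ⟨C₁, hC₁, hapr⟩ := exists_norm_le_two_mul_after
  refine ⟨(32 * C₁)⁻¹, by positivity, ?_⟩
  intro ν T u p hν hT hcl hLH hbdd hunb t₀ ht₀
  by_contra hno
  push Not at hno
  have hTt : 0 < T - t₀ := sub_pos.2 ht₀.2
  set V₀ : ℝ := (32 * C₁)⁻¹ * Real.sqrt ν / Real.sqrt (T - t₀) with hV₀
  have hV₀pos : 0 < V₀ := by positivity
  have hu₀b : ∀ y, ‖u t₀ y‖ ≤ V₀ := fun y => (hno y).le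
  -- the window `64 C₁² V₀² (T - t₀) < ν`: indeed `64 C₁² V₀² (T − t₀) = ν/16`
  have hwin : 64 * C₁ ^ 2 * V₀ ^ 2 * (T - t₀) < ν := by
    have h1 : V₀ ^ 2 * (T - t₀) = ((32 * C₁)⁻¹) ^ 2 * ν := by
      rw [hV₀, div_pow, mul_pow, Real.sq_sqrt hν.le, Real.sq_sqrt hTt.le]
      field_simp
    have h2 : 64 * C₁ ^ 2 * V₀ ^ 2 * (T - t₀) = ν / 16 := by
      rw [mul_assoc (64 * C₁ ^ 2), h1]
      field_simp
      ring
    rw [h2]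
    linarith
  -- Leray's (3.15) on `[t₀, T)`, the slab bound on `[0, t₀]`
  have hlate : ∀ t ∈ Ico t₀ T, ∀ x, ‖u t x‖ ≤ 2 * V₀ := fun t ht x =>
    hapr hν hT hcl hLH hbdd ht₀ hV₀pos hu₀b t ht
      (lt_of_le_of_lt (mul_le_mul_of_nonneg_left (by linarith [ht.2]) (by positivity)) hwin) x
  refine hunb ?_
  rcases ht₀.1.eq_or_lt with h0 | ht₀pos
  · exact ⟨2 * V₀, fun t ht x => hlate t ⟨h0.symm.le.trans ht.1, ht.2⟩ x⟩
  · obtain ⟨M₀, hM₀⟩ := hbdd t₀ ⟨ht₀pos, ht₀.2⟩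
    refine ⟨max M₀ (2 * V₀), fun t ht x => ?_⟩
    rcases le_or_gt t t₀ with h | h
    · exact (hM₀ t ⟨ht.1, h⟩ x).trans (le_max_left _ _)
    · exact (hlate t ⟨h.le, ht.2⟩ x).trans (le_max_right _ _)

end Leray

/-! ### §W. Bounded continuous Oseen-mild fields on a time window: KNSS 2009 §4 regularity -/

section Window

variable {A M : ℝ} {u : ℝ → EuclideanSpace ℝ (Fin 3) → EuclideanSpace ℝ (Fin 3)}

/-- The clamp `τ ↦ max a (min (τ + a) b)` is continuous, takes values in `[a, b]` (`a ≤ b`) and is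
the shift `τ + a` for `τ ∈ [0, b - a]`. [folklore] -/
private theorem clampShift_facts' {a b : ℝ} (hab : a ≤ b) :
    Continuous (fun τ : ℝ => max a (min (τ + a) b)) ∧
      (∀ τ : ℝ, max a (min (τ + a) b) ∈ Icc a b) ∧
      ∀ τ ∈ Icc 0 (b - a), max a (min (τ + a) b) = τ + a :=
  ⟨continuous_const.max ((continuous_id.add continuous_const).min continuous_const), fun τ =>
    ⟨le_max_left _ _, max_le hab (min_le_right _ _)⟩, fun τ hτ => by
    rw [min_eq_left (by linarith [hτ.2]), max_eq_right (by linarith [hτ.1])]⟩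

/-- **A bounded continuous Oseen-mild field on `(A, 0)` is a restarted bounded mild field of
KNSS 2009, §4 on every window `(a, b)`, `A < a < b < 0`** (KNSS 2009, §4 (i): "`u` satisfies
(4.4) [`u(t) = S(t)u₀ − B(u,u)(t)`] … for a suitable `u₀`", here `u₀ = u(a)`): the clamped shift
`V τ x = u (max a (min (τ + a) b)) x` satisfies `IsKNSSDriftMild (b − a) M V 0` — jointly
measurable (continuous), bounded by `M` on the window, weakly divergence free, and
`V(t) = e^{(t−s)Δ}V(s) − ∫ₛᵗ e^{(t−σ)Δ}P∇·(V⊗V)` for `0 < s < t < b − a`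
(`driftDuhamel_zero_eq_oseenDuhamel`, `oseenDuhamel_translate`). The bounded twin of the Type-I
window lemma used Summits-side for singular zooms. [cite: KochNadirashviliSereginSverak2009, §4 (i) with (4.3)–(4.4) (arXiv:0709.3599v1 p. 8)] -/
theorem isKNSSDriftMild_window_of_bounded (hc : ContinuousOn (uncurry u) (Ioo A 0 ×ˢ univ))
    (hdiv : ∀ t ∈ Ioo A 0, IsWeaklyDivFree (u t))
    (hmild : ∀ s t : ℝ, A < s → s < t → t < 0 → ∀ x,
      u t x = UnboundedOperators.heatExtension (u s) (t - s) x - oseenDuhamel 1 s u u t x)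
    (hbd : ∀ t ∈ Ioo A 0, ∀ x, ‖u t x‖ ≤ M) {a b : ℝ} (hAa : A < a) (hab : a < b) (hb : b < 0) :
    IsKNSSDriftMild (b - a) M (fun τ x => u (max a (min (τ + a) b)) x) 0 := by
  obtain ⟨hκc, hκmem, hκid⟩ := clampShift_facts' hab.le
  have hbI : b ∈ Ioo A 0 := ⟨hAa.trans hab, hb⟩
  have hM0 : 0 ≤ M := (norm_nonneg _).trans (hbd b hbI 0)
  have hκneg : ∀ τ, max a (min (τ + a) b) < 0 := fun τ => (hκmem τ).2.trans_lt hb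
  have hκA : ∀ τ, A < max a (min (τ + a) b) := fun τ => hAa.trans_le (hκmem τ).1
  have hκI : ∀ τ, max a (min (τ + a) b) ∈ Ioo A 0 := fun τ => ⟨hκA τ, hκneg τ⟩
  have hcont : Continuous (uncurry fun τ x => u (max a (min (τ + a) b)) x) := by
    have hmap : Continuous fun p : ℝ × EuclideanSpace ℝ (Fin 3) =>
        (max a (min (p.1 + a) b), p.2) :=
      (hκc.comp continuous_fst).prodMk continuous_snd
    have hinto : ∀ p : ℝ × EuclideanSpace ℝ (Fin 3),
        (max a (min (p.1 + a) b), p.2) ∈ Ioo A (0 : ℝ) ×ˢ (univ : Set (EuclideanSpace ℝ (Fin 3))) :=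
      fun p => ⟨hκI p.1, mem_univ _⟩
    exact (hc.comp_continuous hmap hinto).congr fun p => rfl
  have hslice : ∀ t ∈ Ioo A 0, Continuous (u t) := fun t ht =>
    hc.comp_continuous (Continuous.prodMk_right t) fun x => ⟨ht, mem_univ x⟩
  have hbd' : ∀ τ ∈ Ioo 0 (b - a), ∀ x, ‖u (max a (min (τ + a) b)) x‖ ≤ M := fun τ _ x =>
    hbd _ (hκI τ) x
  refine IsKNSSDriftMild.mk measurable_const (fun t => by simpa using hM0) hcont.measurable hbd'
    ?_ ?_
  · exact Eventually.of_forall fun τ => hdiv _ (hκI τ)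
  · intro s t hs hst htT x
    have hsid : max a (min (s + a) b) = s + a := hκid s ⟨hs.le, (hst.trans htT).le⟩
    have htid : max a (min (t + a) b) = t + a := hκid t ⟨(hs.trans hst).le, htT.le⟩
    have hVm : ∀ σ ∈ Ioo s t, Measurable fun x => u (max a (min (σ + a) b)) x := fun σ _ =>
      (hslice _ (hκI σ)).measurable
    have hVN : ∀ σ ∈ Ioo s t, ∀ y, ‖u (max a (min (σ + a) b)) y‖ ≤ M :=
      fun σ hσ y => hbd' σ ⟨hs.trans hσ.1, hσ.2.trans htT⟩ y
    rw [driftDuhamel_zero_eq_oseenDuhamel finrank_euclideanSpace_fin hVm hVN hst.le x]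
    have hcongr : ∀ τ ∈ Ioo s t, (fun x => u (max a (min (τ + a) b)) x) = (fun σ => u (σ + a)) τ :=
      fun τ hτ => by
        funext y
        rw [hκid τ ⟨(hs.trans hτ.1).le, (hτ.2.trans htT).le⟩]
    rw [oseenDuhamel_congr_Ioo hcongr hcongr x, oseenDuhamel_translate]
    simp only [hsid, htid]
    have h := hmild (s + a) (t + a) (by linarith) (by linarith) (by linarith) x
    rwa [show t + a - (s + a) = t - s by ring] at h

/-- **Joint smoothness on a window** `(a, b)`, `A < a < b < 0`, of a bounded continuous Oseen-mild
field on `(A, 0)` (KNSS 2009, Prop. 4.1, the tree's `KNSS2009_prop41_mild_holds`, transported back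
along the shift `t ↦ t − a`). [cite: KochNadirashviliSereginSverak2009, Prop. 4.1 (arXiv:0709.3599v1 p. 8)] -/
theorem isSmoothSpaceTimeOn_window_of_bounded (hc : ContinuousOn (uncurry u) (Ioo A 0 ×ˢ univ))
    (hdiv : ∀ t ∈ Ioo A 0, IsWeaklyDivFree (u t))
    (hmild : ∀ s t : ℝ, A < s → s < t → t < 0 → ∀ x,
      u t x = UnboundedOperators.heatExtension (u s) (t - s) x - oseenDuhamel 1 s u u t x)
    (hbd : ∀ t ∈ Ioo A 0, ∀ x, ‖u t x‖ ≤ M) {a b : ℝ} (hAa : A < a) (hab : a < b) (hb : b < 0) :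
    IsSmoothSpaceTimeOn (Ioo a b) u := by
  obtain ⟨-, -, hκid⟩ := clampShift_facts' hab.le
  have hK := isKNSSDriftMild_window_of_bounded hc hdiv hmild hbd hAa hab hb
  obtain ⟨ε, -, Cst, -, hP⟩ := KNSS2009_prop41_mild_holds 0
  obtain ⟨hsm, -⟩ := hP hK
  have hmap : ContDiff ℝ ((⊤ : ℕ∞) : WithTop ℕ∞)
      fun p : ℝ × EuclideanSpace ℝ (Fin 3) => (p.1 - a, p.2) :=
    (contDiff_fst.sub contDiff_const).prodMk contDiff_snd
  have hinto : MapsTo (fun p : ℝ × EuclideanSpace ℝ (Fin 3) => (p.1 - a, p.2)) (Ioo a b ×ˢ univ)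
      (Ioo 0 (b - a) ×ˢ univ) := by
    rintro ⟨t, x⟩ ⟨ht, -⟩
    exact ⟨⟨by linarith [ht.1], by linarith [ht.2]⟩, mem_univ _⟩
  have hcomp := hsm.comp hmap.contDiffOn hinto
  refine hcomp.congr ?_
  rintro ⟨t, x⟩ ⟨ht, -⟩
  simp only [comp_apply, uncurry_apply_pair]
  rw [hκid (t - a) ⟨by linarith [ht.1], by linarith [ht.2]⟩, sub_add_cancel]

/-- **Joint smoothness on the whole domain** `(A, 0) × ℝ³` of a bounded continuous Oseen-mild
field on `(A, 0)` (smoothness is local: every `A < t < 0` lies in a window `((A+t)/2, t/2)`).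
[cite: KochNadirashviliSereginSverak2009, Prop. 4.1 (arXiv:0709.3599v1 p. 8)] -/
theorem contDiffOn_of_bounded_oseenMild (hc : ContinuousOn (uncurry u) (Ioo A 0 ×ˢ univ))
    (hdiv : ∀ t ∈ Ioo A 0, IsWeaklyDivFree (u t))
    (hmild : ∀ s t : ℝ, A < s → s < t → t < 0 → ∀ x,
      u t x = UnboundedOperators.heatExtension (u s) (t - s) x - oseenDuhamel 1 s u u t x)
    (hbd : ∀ t ∈ Ioo A 0, ∀ x, ‖u t x‖ ≤ M) :
    ContDiffOn ℝ (⊤ : ℕ∞) (uncurry u) (Ioo A 0 ×ˢ univ) := by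
  refine contDiffOn_of_locally_contDiffOn ?_
  rintro ⟨t, x⟩ ⟨ht, -⟩
  have htA : A < t := ht.1
  have ht0 : t < 0 := ht.2
  refine ⟨Ioo ((A + t) / 2) (t / 2) ×ˢ univ, isOpen_Ioo.prod isOpen_univ,
    ⟨⟨by linarith, by linarith⟩, mem_univ _⟩, ?_⟩
  have h := isSmoothSpaceTimeOn_window_of_bounded hc hdiv hmild hbd (a := (A + t) / 2) (b := t / 2)
    (by linarith) (by linarith) (by linarith)
  exact ContDiffOn.mono h inter_subset_right

/-- **Uniform bounds for all `x`-derivatives on a window** (KNSS 2009, (4.10): "`‖u‖_{C^k_par}`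
… `≤ C(k, ‖u‖_∞)`", the tree's `KNSSBootstrap.exists_norm_iteratedFDeriv_slice_le`): for a bound
`M`, an order `k`, a window length `ℓ > 0` and a margin `δ > 0` there is ONE constant
`K = K(M, k, ℓ, δ)` such that `‖Dᵏu(t)(x)‖ ≤ K` for all `t ∈ [a + δ, a + ℓ)`, all `x`, and ALL
bounded (by `M`) continuous Oseen-mild fields `u` on `(A, 0)` and windows `A < a`, `a + ℓ < 0`.
[cite: KochNadirashviliSereginSverak2009, §4 (4.10) with Prop. 4.1 (4.6) (arXiv:0709.3599v1 p. 8)] -/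
theorem exists_norm_iteratedFDeriv_le_of_bounded_oseenMild (M : ℝ) (k : ℕ) {ℓ δ : ℝ} (hℓ : 0 < ℓ)
    (hδ : 0 < δ) :
    ∃ K : ℝ, ∀ ⦃A a : ℝ⦄ ⦃u : ℝ → EuclideanSpace ℝ (Fin 3) → EuclideanSpace ℝ (Fin 3)⦄, A < a →
      a + ℓ < 0 →
      ContinuousOn (uncurry u) (Ioo A 0 ×ˢ univ) →
      (∀ t ∈ Ioo A 0, IsWeaklyDivFree (u t)) →
      (∀ s t : ℝ, A < s → s < t → t < 0 → ∀ x,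
        u t x = UnboundedOperators.heatExtension (u s) (t - s) x - oseenDuhamel 1 s u u t x) →
      (∀ t ∈ Ioo A 0, ∀ x, ‖u t x‖ ≤ M) →
      ∀ t ∈ Ico (a + δ) (a + ℓ), ∀ x, ‖iteratedFDeriv ℝ k (u t) x‖ ≤ K := by
  obtain ⟨Cf, hCf⟩ := KNSSBootstrap.exists_norm_iteratedFDeriv_slice_le
    (E := EuclideanSpace ℝ (Fin 3)) finrank_euclideanSpace_fin (T := ℓ) (N := M) k
  refine ⟨Cf δ, fun A a u hAa haℓ hc hdiv hmild hbd t ht x => ?_⟩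
  have hab : a < a + ℓ := by linarith
  obtain ⟨-, -, hκid⟩ := clampShift_facts' hab.le
  have hK := isKNSSDriftMild_window_of_bounded hc hdiv hmild hbd hAa hab haℓ
  rw [show a + ℓ - a = ℓ by ring] at hK
  have h : ‖iteratedFDeriv ℝ k (fun y => u (max a (min (t - a + a) (a + ℓ))) y) x‖ ≤ Cf δ :=
    hCf hK δ hδ (t - a) ⟨by linarith [ht.1], by linarith [ht.2]⟩ x
  have hV : (fun y => u (max a (min (t - a + a) (a + ℓ))) y) = u t := by
    funext y
    rw [hκid (t - a) ⟨by linarith [ht.1], by linarith [ht.2]⟩, sub_add_cancel]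
  rwa [hV] at h

end Window

/-! ### §Z. The near-maximum zoom of a classical Leray–Hopf solution: Oseen equation, bounds -/

section Oseen

variable {ν T : ℝ} {u : ℝ → EuclideanSpace ℝ (Fin 3) → EuclideanSpace ℝ (Fin 3)}
  {p : ℝ → EuclideanSpace ℝ (Fin 3) → ℝ}

/-- **The Oseen integral equation of a classical Leray–Hopf solution bounded on closed sub-strips,
between positive times**: for `ν > 0`, `0 < T`, a classical solution on `ℝ³ × [0, T)`, Leray–Hopf
from `u 0`, bounded on every `[0, T₁] × ℝ³`, `T₁ < T`, and `0 < s < t < T`: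
`u(t) = e^{ν(t−s)Δ}u(s) − B^ν_s(u, u)(t)` pointwise (Lemarié-Rieusset 2016, Thm. 6.1 / Fabes–Jones–
Rivière 1972: the tree's `ae_eq_heatExtension_sub_oseenDuhamel_of_isMildNSSolutionOn` for the bounded
finite-energy duality-mild field `u`, restarted at `s` by `oseenMild_restart_holds`, and upgraded from
a.e. to everywhere by continuity of both sides; the Literature port of the Summits-side
`oseen_eq_of_classical_of_slab`). [cite: LemarieRieusset2016, Thm. 6.1 with Prop. 6.5 (pp. 133–136)] -/
theorem oseen_eq_of_classical_of_slabBounds (hν : 0 < ν) (hT : 0 < T)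
    (hsol : IsClassicalNSSolutionOn (Ico 0 T) ν 0 u p) (hLH : IsLerayHopfOn T ν 0 (u 0) u)
    (hbdd : ∀ T₁ ∈ Ioo 0 T, ∃ M : ℝ, ∀ t ∈ Icc 0 T₁, ∀ x, ‖u t x‖ ≤ M)
    {s t : ℝ} (hs : 0 < s) (hst : s < t) (htT : t < T)
    (x : EuclideanSpace ℝ (Fin 3)) :
    u t x = UnboundedOperators.heatExtension (u s) (ν * (t - s)) x - oseenDuhamel ν s u u t x := by
  have hcont : ContinuousOn (uncurry u) (Ico 0 T ×ˢ univ) := hsol.smooth_velocity.continuousOn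
  have hmeasT : AEStronglyMeasurable (uncurry u) (volume.restrict (Ioo 0 T ×ˢ univ)) :=
    (hcont.mono (prod_mono Ioo_subset_Ico_self Subset.rfl)).aestronglyMeasurable
      (measurableSet_Ioo.prod MeasurableSet.univ)
  have hslc : ∀ τ ∈ Ico 0 T, Continuous (u τ) := fun τ hτ =>
    (hsol.contDiff_velocity hτ).continuous
  have hsl : ∀ τ ∈ Ico 0 T, AEStronglyMeasurable (u τ) volume := fun τ hτ =>
    (hslc τ hτ).aestronglyMeasurable
  have hdiv0 : IsWeaklyDivFree (u 0) := hLH.isWeaklyDivFree_datum hT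
  have hu02 : MemLp (u 0) 2 volume := hLH.memLp 0 ⟨le_rfl, hT.le⟩
  have hmildT : IsMildNSSolutionOn (Ioc 0 T) ν 0 (u 0) u :=
    isMildNSSolutionOn_of_isLerayHopfOn_holds hν hT hu02 hLH
  -- the representation from time `0`, a.e., at every `t ∈ (0, T)`
  have hrepr : ∀ τ ∈ Ioo 0 T, u τ =ᵐ[volume] fun y =>
      UnboundedOperators.heatExtension (u 0) (ν * τ) y - oseenDuhamel ν 0 u u τ y := by
    intro τ hτ
    set T' : ℝ := (τ + T) / 2 with hT'
    have hT'0 : 0 < T' := by rw [hT']; linarith [hτ.1]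
    have hτT' : τ < T' := by rw [hT']; linarith [hτ.2]
    have hT'T : T' < T := by rw [hT']; linarith [hτ.2]
    obtain ⟨M, hM⟩ := hbdd T' ⟨hT'0, hT'T⟩
    have hM' : ∀ σ ∈ Icc 0 T', ∀ y, ‖u σ y‖ ≤ max M 1 := fun σ hσ y =>
      (hM σ hσ y).trans (le_max_left _ _)
    exact ae_eq_heatExtension_sub_oseenDuhamel_of_isMildNSSolutionOn hν hT'0
      (hmildT.mono (Ioc_subset_Ioc_right hT'T.le))
      (hmeasT.mono_measure (Measure.restrict_mono (prod_mono (Ioo_subset_Ioo_right hT'T.le)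
        Subset.rfl) le_rfl))
      (fun σ hσ => hsl σ ⟨hσ.1, hσ.2.trans_lt hT'T⟩) (lt_of_lt_of_le one_pos (le_max_right _ _))
      hM' hdiv0 (fun σ hσ => hLH.memLp σ ⟨hσ.1, hσ.2.trans hT'T.le⟩) ⟨hτ.1, hτT'.le⟩
  -- uniform essential bounds on sub-strips
  have hbounds : ∀ T₁ ∈ Ioo 0 T, ∃ C : ℝ≥0∞, C < ∞ ∧ ∀ τ ∈ Ico 0 T₁, eLpNorm (u τ) ∞ volume ≤ C := by
    intro T₁ hT₁
    obtain ⟨M, hM⟩ := hbdd T₁ hT₁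
    refine ⟨ENNReal.ofReal M, ENNReal.ofReal_lt_top, fun τ hτ => ?_⟩
    rw [eLpNorm_exponent_top]
    exact eLpNormEssSup_le_of_ae_bound (Eventually.of_forall fun y => hM τ ⟨hτ.1, hτ.2.le⟩ y)
  -- restart at `s`, a.e.
  have hae : u t =ᵐ[volume] fun y =>
      UnboundedOperators.heatExtension (u s) (ν * (t - s)) y - oseenDuhamel ν s u u t y :=
    oseenMild_restart_holds (EuclideanSpace ℝ (Fin 3)) hν hT hmeasT (hsl 0 ⟨le_rfl, hT⟩) hbounds
      hrepr hs hst htT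
  -- both sides are continuous in `x`
  obtain ⟨M, hM⟩ := hbdd ((t + T) / 2) ⟨by linarith, by linarith⟩
  have hM0 : 0 ≤ M := (norm_nonneg _).trans (hM 0 ⟨le_rfl, by linarith⟩ 0)
  have hsI : s ∈ Ico 0 T := ⟨hs.le, hst.trans htT⟩
  have hheat : Continuous fun y => UnboundedOperators.heatExtension (u s) (ν * (t - s)) y :=
    (UnboundedOperators.contDiff_heatExtension_of_bound (m := 0) (hslc s hsI)
      (fun z => hM s ⟨hs.le, by linarith⟩ z) (mul_pos hν (sub_pos.2 hst))).continuous
  have hmeas_st : AEStronglyMeasurable (uncurry u)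
      ((volume : Measure (ℝ × EuclideanSpace ℝ (Fin 3))).restrict (Ioo s t ×ˢ univ)) :=
    hmeasT.mono_measure (Measure.restrict_mono
      (prod_mono (Ioo_subset_Ioo hs.le htT.le) Subset.rfl) le_rfl)
  have hbd_st : ∀ τ ∈ Ioo s t, ∀ y, ‖u τ y‖ ≤ M := fun τ hτ y =>
    hM τ ⟨(hs.trans hτ.1).le, by linarith [hτ.2]⟩ y
  have hduh : Continuous (oseenDuhamel ν s u u t) :=
    continuous_oseenDuhamel_slice hν hM0 hmeas_st hmeas_st hbd_st hbd_st hst le_rfl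
  have heq := (Continuous.ae_eq_iff_eq volume (hslc t ⟨hs.le.trans hst.le, htT⟩)
    (hheat.sub hduh)).1 hae
  exact congrFun heq x

/-- **The Oseen equation at unit viscosity for the normalised field** `ũ = timeRescale ν⁻¹ ν⁻¹ u`,
`ũ(s, x) = ν⁻¹u(s/ν, x)`, of a classical Leray–Hopf solution bounded on closed sub-strips: for
`0 < σ < τ < νT`, `ũ(τ) = e^{(τ−σ)Δ}ũ(σ) − B¹_σ(ũ, ũ)(τ)` pointwise (KNSS 2009, §1 (1.1): `ν = 1`
by rescaling). [cite: KochNadirashviliSereginSverak2009, §1 (1.1) (arXiv p. 2)] -/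
theorem oseen_eq_timeRescale_of_classical_of_slabBounds (hν : 0 < ν) (hT : 0 < T)
    (hsol : IsClassicalNSSolutionOn (Ico 0 T) ν 0 u p) (hLH : IsLerayHopfOn T ν 0 (u 0) u)
    (hbdd : ∀ T₁ ∈ Ioo 0 T, ∃ M : ℝ, ∀ t ∈ Icc 0 T₁, ∀ x, ‖u t x‖ ≤ M)
    {σ τ : ℝ} (hσ : 0 < σ) (hστ : σ < τ) (hτ : τ < ν * T)
    (x : EuclideanSpace ℝ (Fin 3)) :
    timeRescale ν⁻¹ ν⁻¹ u τ x =
      UnboundedOperators.heatExtension (timeRescale ν⁻¹ ν⁻¹ u σ) (τ - σ) x -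
        oseenDuhamel 1 σ (timeRescale ν⁻¹ ν⁻¹ u) (timeRescale ν⁻¹ ν⁻¹ u) τ x := by
  have hν0 : ν ≠ 0 := hν.ne'
  obtain ⟨s, rfl⟩ : ∃ s, σ = ν * s := ⟨ν⁻¹ * σ, by field_simp⟩
  obtain ⟨t, rfl⟩ : ∃ t, τ = ν * t := ⟨ν⁻¹ * τ, by field_simp⟩
  have hs : 0 < s := by
    rcases lt_or_ge 0 s with h | h
    · exact h
    · nlinarith
  have hst : s < t := lt_of_mul_lt_mul_left hστ hν.le
  have htT : t < T := lt_of_mul_lt_mul_left hτ hν.le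
  rw [oseenDuhamel_one_timeRescale hν u hst.le x, timeRescale_apply, timeRescale_slice,
    UnboundedOperators.heatExtension_const_smul, show ν⁻¹ * (ν * t) = t by field_simp,
    show ν⁻¹ * (ν * s) = s by field_simp, show ν * t - ν * s = ν * (t - s) by ring, ← smul_sub,
    oseen_eq_of_classical_of_slabBounds hν hT hsol hLH hbdd hs hst htT x]

end Oseen

section Zoom

variable {ν T : ℝ} {u : ℝ → EuclideanSpace ℝ (Fin 3) → EuclideanSpace ℝ (Fin 3)}
  {p : ℝ → EuclideanSpace ℝ (Fin 3) → ℝ} {t₀ lam : ℝ} {x₀ : EuclideanSpace ℝ (Fin 3)}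

/-- **The near-maximum zoom in terms of the viscosity-normalised field**: with `ũ = timeRescale ν⁻¹ ν⁻¹ u`,
`(λ/ν) • u ∘ Φ = λ • stPull (λ²) λ (νt₀) x₀ ũ`, `Φ(s, y) = (t₀ + (λ²/ν) s, x₀ + λ y)` (Giga–Miura's
`u_k(x,t) = λ_k u(x_k + λ_k x, t_k + λ_k² t)` at `ν = 1`, HUPS #956 p. 5). [cite: GigaMiura2011, §2.1 p. 5 (the rescaled solutions u_k)] -/
theorem zoom_eq_smul_stPull_timeRescale' (hν : 0 < ν) :
    ((lam / ν) • stPull (lam ^ 2 / ν) lam t₀ x₀ u) =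
      lam • stPull (lam ^ 2) lam (ν * t₀) x₀ (timeRescale ν⁻¹ ν⁻¹ u) := by
  have hν0 : ν ≠ 0 := hν.ne'
  funext s y
  have h1 : lam / ν = lam * ν⁻¹ := div_eq_mul_inv _ _
  have h2 : t₀ + lam ^ 2 / ν * s = ν⁻¹ * (ν * t₀ + lam ^ 2 * s) := by field_simp
  rw [smul_stPull_apply, smul_stPull_apply, timeRescale_apply, smul_smul, h1, h2]

/-- **The zoom is a classical unit-viscosity solution** on the pull-back `Φ⁻¹[0, T)` of the life
span (Leray's similarity transformation `IsClassicalNSSolutionOn.stRescale` with amplitude `λ/ν`,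
space scale `λ`, time scale `λ²/ν`: viscosity `(λ/ν)ν/λ = 1`, no force). [cite: Leray1934, §20] -/
theorem zoom_isClassical' (hν : 0 < ν) (hsol : IsClassicalNSSolutionOn (Ico 0 T) ν 0 u p)
    (hlam : 0 < lam) :
    IsClassicalNSSolutionOn ((fun r => t₀ + lam ^ 2 / ν * r) ⁻¹' Ico 0 T) 1 0
      ((lam / ν) • stPull (lam ^ 2 / ν) lam t₀ x₀ u)
      ((lam / ν) ^ 2 • stPull (lam ^ 2 / ν) lam t₀ x₀ p) := by
  have hα : 0 < lam / ν := div_pos hlam hν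
  have hβ : lam ^ 2 / ν = lam / ν * lam := by rw [pow_two]; ring
  have key := hsol.stRescale hα hlam hβ t₀ x₀
  have hvisc : lam / ν * ν / lam = 1 := by
    field_simp
  have hforce : (((lam / ν) ^ 2 * lam) • stPull (lam ^ 2 / ν) lam t₀ x₀
      (0 : ℝ → EuclideanSpace ℝ (Fin 3) → EuclideanSpace ℝ (Fin 3))) = 0 := by
    funext s y; simp [stPull]
  rw [hvisc, hforce] at key
  exact key

/-- Window bookkeeping for the zoom about `(t₀, x₀)`, `0 < t₀ < T`: the zoom time `s` is sent to
the physical time `t₀ + (λ²/ν) s`, which lies in `(0, T)` exactly when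
`−t₀ν/λ² < s < (T − t₀)ν/λ²`. [folklore] -/
private theorem zoom_time_mem' (hν : 0 < ν) (hlam : 0 < lam) {s : ℝ}
    (hs : s ∈ Ioo (-(t₀ * ν / lam ^ 2)) ((T - t₀) * ν / lam ^ 2)) :
    t₀ + lam ^ 2 / ν * s ∈ Ioo 0 T := by
  have hl2 : 0 < lam ^ 2 := by positivity
  have hc : 0 < lam ^ 2 / ν := div_pos hl2 hν
  constructor
  · have h1 : -(t₀ * ν / lam ^ 2) < s := hs.1
    have h2 : lam ^ 2 / ν * (-(t₀ * ν / lam ^ 2)) < lam ^ 2 / ν * s := mul_lt_mul_of_pos_left h1 hc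
    have h3 : lam ^ 2 / ν * (-(t₀ * ν / lam ^ 2)) = -t₀ := by
      field_simp
    linarith
  · have h1 : s < (T - t₀) * ν / lam ^ 2 := hs.2
    have h2 : lam ^ 2 / ν * s < lam ^ 2 / ν * ((T - t₀) * ν / lam ^ 2) :=
      mul_lt_mul_of_pos_left h1 hc
    have h3 : lam ^ 2 / ν * ((T - t₀) * ν / lam ^ 2) = T - t₀ := by
      field_simp
    linarith

/-- **The zoom is a classical unit-viscosity solution on its window** `(−t₀ν/λ², (T − t₀)ν/λ²)`.
[cite: Leray1934, §20] -/
theorem zoom_isClassical_window (hν : 0 < ν) (hsol : IsClassicalNSSolutionOn (Ico 0 T) ν 0 u p)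
    (hlam : 0 < lam) :
    IsClassicalNSSolutionOn (Ioo (-(t₀ * ν / lam ^ 2)) ((T - t₀) * ν / lam ^ 2)) 1 0
      ((lam / ν) • stPull (lam ^ 2 / ν) lam t₀ x₀ u)
      ((lam / ν) ^ 2 • stPull (lam ^ 2 / ν) lam t₀ x₀ p) :=
  (zoom_isClassical' (t₀ := t₀) (x₀ := x₀) hν hsol hlam).mono
    (fun _ hs => Ioo_subset_Ico_self (zoom_time_mem' (T := T) hν hlam hs)) isOpen_Ioo.uniqueDiffOn

/-- **The Oseen integral equation of the zoom on its window** (KNSS 2009, §1 (1.2) and proof of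
Thm 6.2, p. 13: the rescaled solutions "are mild solutions … for suitable re-scalings of the initial
datum"; Giga–Miura 2011 p. 5: "`(u_k, p_k)` is also the solution of (1.1)"): for
`−t₀ν/λ² < σ < τ < (T − t₀)ν/λ²` the zoom `w = (λ/ν) • u ∘ Φ` satisfies
`w(τ) = e^{(τ−σ)Δ}w(σ) − B¹_σ(w, w)(τ)` pointwise (`oseen_smul_stPull` over
`oseen_eq_timeRescale_of_classical_of_slabBounds`). [cite: KochNadirashviliSereginSverak2009, §1 (1.2) and proof of Thm 6.2 (arXiv p. 13)] -/
theorem zoom_oseen_window (hν : 0 < ν) (hT : 0 < T)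
    (hsol : IsClassicalNSSolutionOn (Ico 0 T) ν 0 u p) (hLH : IsLerayHopfOn T ν 0 (u 0) u)
    (hbdd : ∀ T₁ ∈ Ioo 0 T, ∃ M : ℝ, ∀ t ∈ Icc 0 T₁, ∀ x, ‖u t x‖ ≤ M)
    (hlam : 0 < lam) {σ τ : ℝ} (hσ : -(t₀ * ν / lam ^ 2) < σ) (hστ : σ < τ)
    (hτ : τ < (T - t₀) * ν / lam ^ 2) (y : EuclideanSpace ℝ (Fin 3)) :
    ((lam / ν) • stPull (lam ^ 2 / ν) lam t₀ x₀ u) τ y =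
      UnboundedOperators.heatExtension (((lam / ν) • stPull (lam ^ 2 / ν) lam t₀ x₀ u) σ) (τ - σ) y -
        oseenDuhamel 1 σ ((lam / ν) • stPull (lam ^ 2 / ν) lam t₀ x₀ u)
          ((lam / ν) • stPull (lam ^ 2 / ν) lam t₀ x₀ u) τ y := by
  have hν0 : ν ≠ 0 := hν.ne'
  have hl2 : 0 < lam ^ 2 := by positivity
  have hσI : σ ∈ Ioo (-(t₀ * ν / lam ^ 2)) ((T - t₀) * ν / lam ^ 2) := ⟨hσ, hστ.trans hτ⟩
  have hτI : τ ∈ Ioo (-(t₀ * ν / lam ^ 2)) ((T - t₀) * ν / lam ^ 2) := ⟨hσ.trans hστ, hτ⟩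
  have hσ' : 0 < ν * t₀ + lam ^ 2 * σ := by
    have h := (zoom_time_mem' (T := T) hν hlam hσI).1
    have e : ν * t₀ + lam ^ 2 * σ = ν * (t₀ + lam ^ 2 / ν * σ) := by field_simp
    rw [e]; exact mul_pos hν h
  have hτ' : ν * t₀ + lam ^ 2 * τ < ν * T := by
    have h := (zoom_time_mem' (T := T) hν hlam hτI).2
    have e : ν * t₀ + lam ^ 2 * τ = ν * (t₀ + lam ^ 2 / ν * τ) := by field_simp
    rw [e]; exact mul_lt_mul_of_pos_left h hν
  have hστ' : ν * t₀ + lam ^ 2 * σ < ν * t₀ + lam ^ 2 * τ := by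
    have := mul_lt_mul_of_pos_left hστ hl2
    linarith
  rw [zoom_eq_smul_stPull_timeRescale' (t₀ := t₀) (x₀ := x₀) (u := u) (lam := lam) hν]
  exact oseen_smul_stPull hlam (ν * t₀) x₀ hστ (fun X =>
    oseen_eq_timeRescale_of_classical_of_slabBounds hν hT hsol hLH hbdd hσ' hστ' hτ' X) y

/-- The slices of the zoom on its window are weakly divergence free (they are `C¹` and divergence
free). [folklore] -/
private theorem zoom_isWeaklyDivFree_window (hν : 0 < ν) (hsol : IsClassicalNSSolutionOn (Ico 0 T) ν 0 u p)
    (hlam : 0 < lam) {s : ℝ} (hs : s ∈ Ioo (-(t₀ * ν / lam ^ 2)) ((T - t₀) * ν / lam ^ 2)) :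
    IsWeaklyDivFree (((lam / ν) • stPull (lam ^ 2 / ν) lam t₀ x₀ u) s) := by
  have h := zoom_isClassical_window (t₀ := t₀) (x₀ := x₀) hν hsol hlam (T := T)
  exact VectorCalculus.IsDivFree.isWeaklyDivFree_holds (h.divFree s hs)
    ((h.contDiff_velocity hs).of_le (by exact_mod_cast le_top))

/-- The value of the zoom: `w(s, y) = (λ/ν) u(t₀ + (λ²/ν)s, x₀ + λy)`, so `‖w(s, y)‖ ≤ (λ/ν) K`
whenever `‖u‖ ≤ K` at the physical point. [folklore] -/
private theorem norm_zoom_le (hν : 0 < ν) (hlam : 0 < lam) {s K : ℝ}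
    (hK : ∀ x, ‖u (t₀ + lam ^ 2 / ν * s) x‖ ≤ K) (y : EuclideanSpace ℝ (Fin 3)) :
    ‖((lam / ν) • stPull (lam ^ 2 / ν) lam t₀ x₀ u) s y‖ ≤ lam / ν * K := by
  rw [smul_stPull_apply, norm_smul, Real.norm_of_nonneg (div_pos hlam hν).le]
  exact mul_le_mul_of_nonneg_left (hK _) (div_pos hlam hν).le

/-- The vorticity of the zoom: `curl w(s)(y) = (λ²/ν) ω(t₀ + (λ²/ν)s, x₀ + λy)` (Giga–Miura's
`ω_k(x, t) = λ_k² ω(x_k + λ_k x, t_k + λ_k² t)`, HUPS #956 p. 5, at viscosity `ν`). [cite: GigaMiura2011, §2.1 p. 5] -/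
theorem curl_zoom (s : ℝ) (y : EuclideanSpace ℝ (Fin 3)) :
    curl (((lam / ν) • stPull (lam ^ 2 / ν) lam t₀ x₀ u) s) y =
      (lam ^ 2 / ν) • curl (u (t₀ + lam ^ 2 / ν * s)) (x₀ + lam • y) := by
  rw [curl_smul_stPull, show lam / ν * lam = lam ^ 2 / ν by rw [pow_two]; ring]

end Zoom

/-! ### §C. From locally uniform convergence to convergence of gradients (KNSS Lemma 6.1, C¹ form) -/

section Gradients

variable {M : ℝ} {A : ℕ → ℝ} {w : ℕ → ℝ → EuclideanSpace ℝ (Fin 3) → EuclideanSpace ℝ (Fin 3)}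
  {W : ℝ → EuclideanSpace ℝ (Fin 3) → EuclideanSpace ℝ (Fin 3)}

/-- `fderiv` is the image of `iteratedFDeriv 1` under the currying isometry. [folklore] -/
private theorem fderiv_eq_curry_iteratedFDeriv_one
    (f : EuclideanSpace ℝ (Fin 3) → EuclideanSpace ℝ (Fin 3)) (x : EuclideanSpace ℝ (Fin 3)) :
    fderiv ℝ f x = (continuousMultilinearCurryFin1 ℝ (EuclideanSpace ℝ (Fin 3))
      (EuclideanSpace ℝ (Fin 3))) (iteratedFDeriv ℝ 1 f x) :=
  ContinuousLinearMap.ext fun v => by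
    rw [continuousMultilinearCurryFin1_apply, iteratedFDeriv_one_apply]
    rfl

/-- **Pointwise convergence of bounded Oseen-mild fields upgrades to convergence of the spatial
gradients** (KNSS 2009, Lemma 6.1 with Prop. 4.1: "`u_l` converge locally uniformly … together
with [their derivatives]" — the `C¹_loc` content of the compactness lemma; Giga–Miura 2011 p. 5:
"(`u_k`, `ω_k`) subsequently converges to some (`ū`, `ω̄`) locally uniformly in `ℝ³ × (−∞, 0)` with
its derivatives by (2.1)"). If `w k` are continuous Oseen-mild fields on `(A k, 0)` bounded by `M`,
`A k → −∞`, converging pointwise on the open slab to a continuous bounded Oseen-mild ancient field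
`W`, then `∇w k(t, x) → ∇W(t, x)` at every `t < 0`, `x` (the KNSS §4 bounds (4.10) on all spatial
derivatives are uniform on windows, so Landau's interpolation inequality
`Calculus.tendsto_iteratedFDeriv_of_tendsto` applies). [cite: KochNadirashviliSereginSverak2009, Lemma 6.1 with Prop. 4.1 (4.10) (arXiv:0709.3599 pp. 8, 11)] -/
theorem tendsto_fderiv_of_bounded_oseenMild (hA : Tendsto A atTop atBot)
    (hc : ∀ k, ContinuousOn (uncurry (w k)) (Ioo (A k) 0 ×ˢ univ))
    (hdiv : ∀ k, ∀ t ∈ Ioo (A k) 0, IsWeaklyDivFree (w k t))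
    (hmild : ∀ k, ∀ s t : ℝ, A k < s → s < t → t < 0 → ∀ x,
      w k t x = UnboundedOperators.heatExtension (w k s) (t - s) x - oseenDuhamel 1 s (w k) (w k) t x)
    (hbd : ∀ k, ∀ t ∈ Ioo (A k) 0, ∀ x, ‖w k t x‖ ≤ M)
    (hWc : ContinuousOn (uncurry W) (Iio 0 ×ˢ univ))
    (hWdiv : ∀ t < 0, IsWeaklyDivFree (W t))
    (hWmild : ∀ s t : ℝ, s < t → t < 0 → ∀ x,
      W t x = UnboundedOperators.heatExtension (W s) (t - s) x - oseenDuhamel 1 s W W t x)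
    (hWbd : ∀ t < 0, ∀ x, ‖W t x‖ ≤ M)
    (hpt : ∀ t < 0, ∀ x, Tendsto (fun k => w k t x) atTop (𝓝 (W t x))) {t : ℝ} (ht : t < 0)
    (x : EuclideanSpace ℝ (Fin 3)) :
    Tendsto (fun k => fderiv ℝ (w k t) x) atTop (𝓝 (fderiv ℝ (W t) x)) := by
  -- a window `[a + 1/2, a + 1)` around `t` inside `(a, a + 1)`, `a + 1 < 0`
  set a : ℝ := min (t - 1 / 2) (t / 2 - 1) with ha
  have hat : a + 1 / 2 ≤ t := by
    have : a ≤ t - 1 / 2 := min_le_left _ _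
    linarith
  have hta : t < a + 1 := by
    rcases le_total (t - 1 / 2) (t / 2 - 1) with h | h
    · rw [ha, min_eq_left h]; linarith
    · rw [ha, min_eq_right h]; linarith
  have ha1 : a + 1 < 0 := by
    have : a ≤ t / 2 - 1 := min_le_right _ _
    linarith
  have htI : t ∈ Ico (a + 1 / 2) (a + 1) := ⟨hat, hta⟩
  -- `W` restricted to `(a - 1, 0)`
  have hWc' : ContinuousOn (uncurry W) (Ioo (a - 1) 0 ×ˢ univ) :=
    hWc.mono (prod_mono Ioo_subset_Iio_self Subset.rfl)
  have hWdiv' : ∀ τ ∈ Ioo (a - 1) 0, IsWeaklyDivFree (W τ) := fun τ hτ => hWdiv τ hτ.2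
  have hWmild' : ∀ s' t' : ℝ, a - 1 < s' → s' < t' → t' < 0 → ∀ y,
      W t' y = UnboundedOperators.heatExtension (W s') (t' - s') y - oseenDuhamel 1 s' W W t' y :=
    fun s' t' _ hst ht' y => hWmild s' t' hst ht' y
  have hWbd' : ∀ τ ∈ Ioo (a - 1) 0, ∀ y, ‖W τ y‖ ≤ M := fun τ hτ y => hWbd τ hτ.2 y
  -- eventually `A k < a - 1`
  obtain ⟨k₀, hk₀⟩ : ∃ k₀ : ℕ, ∀ k, k₀ ≤ k → A k < a - 1 := by
    have h := hA.eventually (eventually_lt_atBot (a - 1))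
    obtain ⟨k₀, hk₀⟩ := h.exists_forall_of_atTop
    exact ⟨k₀, hk₀⟩
  -- the shifted sequence: all slices at `t` are smooth
  have hsmk : ∀ j, ContDiff ℝ ((⊤ : ℕ∞) : WithTop ℕ∞) (w (j + k₀) t) := fun j =>
    contDiff_slice_of_contDiffOn
      (contDiffOn_of_bounded_oseenMild (hc _) (hdiv _) (hmild _) (hbd _))
      ⟨(hk₀ _ (Nat.le_add_left k₀ j)).trans (by linarith), ht⟩
  have hsmW : ContDiff ℝ ((⊤ : ℕ∞) : WithTop ℕ∞) (W t) :=
    contDiff_slice_of_contDiffOn (contDiffOn_of_bounded_oseenMild hWc' hWdiv' hWmild' hWbd')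
      ⟨by linarith, ht⟩
  -- uniform bounds of all orders at time `t`, for the tail of the sequence and for `W`
  have hb : ∀ n : ℕ, ∃ K : ℝ, (∀ᶠ j in atTop, ∀ y ∈ ball x 1, ‖iteratedFDeriv ℝ n (w (j + k₀) t) y‖ ≤ K) ∧
      ∀ y ∈ ball x 1, ‖iteratedFDeriv ℝ n (W t) y‖ ≤ K := by
    intro n
    obtain ⟨K, hK⟩ := exists_norm_iteratedFDeriv_le_of_bounded_oseenMild M n (ℓ := 1) (δ := 1 / 2)
      one_pos (by norm_num)
    refine ⟨K, Eventually.of_forall fun j y _ => ?_, fun y _ => ?_⟩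
    · exact hK ((hk₀ _ (Nat.le_add_left k₀ j)).trans (by linarith)) ha1 (hc _) (hdiv _) (hmild _)
        (hbd _) t htI y
    · exact hK (show a - 1 < a by linarith) ha1 hWc' hWdiv' hWmild' hWbd' t htI y
  have h0 : ∀ y ∈ ball x 1, Tendsto (fun j => w (j + k₀) t y) atTop (𝓝 (W t y)) := fun y _ =>
    (tendsto_add_atTop_iff_nat k₀).2 (hpt t ht y)
  have h1 := Calculus.tendsto_iteratedFDeriv_of_tendsto hsmk hsmW one_pos hb h0 1
  -- back to `fderiv`, and un-shift
  have h2 : Tendsto (fun j => fderiv ℝ (w (j + k₀) t) x) atTop (𝓝 (fderiv ℝ (W t) x)) := by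
    simp only [fderiv_eq_curry_iteratedFDeriv_one]
    exact ((continuousMultilinearCurryFin1 ℝ (EuclideanSpace ℝ (Fin 3))
      (EuclideanSpace ℝ (Fin 3))).continuous.tendsto _).comp h1
  exact (tendsto_add_atTop_iff_nat k₀).1 h2

/-- **Convergence of the vorticities** along a pointwise convergent sequence of bounded Oseen-mild
fields (the curl is a continuous linear function of the gradient). [cite: KochNadirashviliSereginSverak2009, Lemma 6.1 with Prop. 4.1 (arXiv:0709.3599 pp. 8, 11)] -/
theorem tendsto_curl_of_bounded_oseenMild (hA : Tendsto A atTop atBot)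
    (hc : ∀ k, ContinuousOn (uncurry (w k)) (Ioo (A k) 0 ×ˢ univ))
    (hdiv : ∀ k, ∀ t ∈ Ioo (A k) 0, IsWeaklyDivFree (w k t))
    (hmild : ∀ k, ∀ s t : ℝ, A k < s → s < t → t < 0 → ∀ x,
      w k t x = UnboundedOperators.heatExtension (w k s) (t - s) x - oseenDuhamel 1 s (w k) (w k) t x)
    (hbd : ∀ k, ∀ t ∈ Ioo (A k) 0, ∀ x, ‖w k t x‖ ≤ M)
    (hWc : ContinuousOn (uncurry W) (Iio 0 ×ˢ univ))
    (hWdiv : ∀ t < 0, IsWeaklyDivFree (W t))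
    (hWmild : ∀ s t : ℝ, s < t → t < 0 → ∀ x,
      W t x = UnboundedOperators.heatExtension (W s) (t - s) x - oseenDuhamel 1 s W W t x)
    (hWbd : ∀ t < 0, ∀ x, ‖W t x‖ ≤ M)
    (hpt : ∀ t < 0, ∀ x, Tendsto (fun k => w k t x) atTop (𝓝 (W t x))) {t : ℝ} (ht : t < 0)
    (x : EuclideanSpace ℝ (Fin 3)) :
    Tendsto (fun k => curl (w k t) x) atTop (𝓝 (curl (W t) x)) := by
  have hD := tendsto_fderiv_of_bounded_oseenMild hA hc hdiv hmild hbd hWc hWdiv hWmild hWbd hpt ht x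
  simp only [curl_eq_curlCLM]
  exact (curlCLM.continuous.tendsto _).comp hD

end Gradients

/-! ### §D. (CA′) passes to the limit along a near-maximum zoom -/

section Passage

variable {ν T : ℝ} {u : ℝ → EuclideanSpace ℝ (Fin 3) → EuclideanSpace ℝ (Fin 3)}

/-- **(CA′) kills the direction modulus along a zoom whose scales obey Leray's rate** (Giga–Miura
2011, proof of Prop. 2.2, first step, HUPS #956 p. 7: "By (CA′) we see that
`|ζ_k(x,t) − ζ_k(y,t)| ≤ η(o(1)|x − y|/√(−t))` for `x, y ∈ K` … Sending `k → ∞` (by taking a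
subsequence) yields `|ζ(x,t) − ζ(y,t)| ≤ 0` … Thus … `ω(x,t) = |ω(x,t)| ζ₀(t)`"). Let `u` satisfy
(CA′) = `HasScaledContinuousAlignment ν T u` and let a vorticity zoom
`y ↦ (λ_j²/ν) ω(t_j, x_j + λ_j y)` with physical times `t_j ∈ (0, T)`, `t_j → T`, scales `λ_j > 0`
with `λ_j ≤ K √(ν(T − t_j))` (Leray's rate for near-maximum scales) converge pointwise to `Ω`. Then
at any two points where `Ω ≠ 0` the directions agree: `Ω(y)/|Ω(y)| = Ω(y')/|Ω(y')|` (the physical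
vorticities `≈ ν|Ω|/λ_j² → ∞` exceed the level `d` eventually, the physical distance is
`λ_j|y − y'|`, so the argument of the modulus is `≤ θ(t_j) K |y − y'| → 0`, and `η` is monotone with
`η(0) = 0`). The Summits-side parabolic-zoom version is `dir_eq_of_scaledAlignment_zoom`.
[cite: GigaMiura2011, Prop. 2.2, proof, first step (§2.1; HUPS preprint #956 p. 7)] -/
theorem dir_eq_of_scaledAlignment_lerayZoom (hT : 0 < T)
    (hCA : HasScaledContinuousAlignment ν T u)
    {xc : ℕ → EuclideanSpace ℝ (Fin 3)} {t : ℕ → ℝ} {lam : ℕ → ℝ} {K : ℝ}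
    {Ω : EuclideanSpace ℝ (Fin 3) → EuclideanSpace ℝ (Fin 3)}
    (ht : ∀ j, t j ∈ Ioo 0 T) (htT : Tendsto t atTop (𝓝 T)) (hlam : ∀ j, 0 < lam j)
    (hlam0 : Tendsto lam atTop (𝓝 0)) (hK : 0 ≤ K)
    (hrate : ∀ j, lam j ≤ K * Real.sqrt (ν * (T - t j)))
    (hconv : ∀ y, Tendsto (fun j => (lam j ^ 2 / ν) • curl (u (t j)) (xc j + lam j • y)) atTop
      (𝓝 (Ω y))) (hν : 0 < ν) :
    ∀ y y', Ω y ≠ 0 → Ω y' ≠ 0 → ‖Ω y‖⁻¹ • Ω y = ‖Ω y'‖⁻¹ • Ω y' := by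
  obtain ⟨d, hd, η, θ, hmono, hηc, hη0, hθ0, hθ, hmod⟩ := hCA
  intro y y' hy hy'
  -- shorthand: physical points, vorticities and the positive scaling factor
  set P : ℕ → EuclideanSpace ℝ (Fin 3) := fun j => xc j + lam j • y with hP
  set P' : ℕ → EuclideanSpace ℝ (Fin 3) := fun j => xc j + lam j • y' with hP'
  set a : ℕ → EuclideanSpace ℝ (Fin 3) := fun j => curl (u (t j)) (P j) with ha
  set b : ℕ → EuclideanSpace ℝ (Fin 3) := fun j => curl (u (t j)) (P' j) with hb
  have hcpos : ∀ j, 0 < lam j ^ 2 / ν := fun j => div_pos (pow_pos (hlam j) 2) hν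
  have hca : Tendsto (fun j => (lam j ^ 2 / ν) • a j) atTop (𝓝 (Ω y)) := hconv y
  have hcb : Tendsto (fun j => (lam j ^ 2 / ν) • b j) atTop (𝓝 (Ω y')) := hconv y'
  -- normalisation: continuous at non-zero limits, invariant under positive scaling
  have hdir : ∀ (v : ℕ → EuclideanSpace ℝ (Fin 3)) (z : EuclideanSpace ℝ (Fin 3)), z ≠ 0 →
      Tendsto (fun j => (lam j ^ 2 / ν) • v j) atTop (𝓝 z) →
      Tendsto (fun j => ‖v j‖⁻¹ • v j) atTop (𝓝 (‖z‖⁻¹ • z)) := by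
    intro v z hz hv
    have h1 : Tendsto (fun j => ‖(lam j ^ 2 / ν) • v j‖⁻¹ • ((lam j ^ 2 / ν) • v j)) atTop
        (𝓝 (‖z‖⁻¹ • z)) := ((hv.norm).inv₀ (norm_ne_zero_iff.mpr hz)).smul hv
    refine h1.congr fun j => ?_
    rw [norm_smul, Real.norm_of_nonneg (hcpos j).le, mul_inv, smul_smul, mul_comm (lam j ^ 2 / ν)⁻¹,
      mul_assoc, inv_mul_cancel₀ (hcpos j).ne', mul_one]
  have hda := hdir a (Ω y) hy hca
  have hdb := hdir b (Ω y') hy' hcb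
  -- the chord of the directions converges to the chord of the limit directions
  have hchord : Tendsto (fun j => ‖‖a j‖⁻¹ • a j - ‖b j‖⁻¹ • b j‖) atTop
      (𝓝 ‖‖Ω y‖⁻¹ • Ω y - ‖Ω y'‖⁻¹ • Ω y'‖) := (hda.sub hdb).norm
  -- the scaling factor tends to zero, so the physical vorticities exceed the level `d` eventually
  have hc0 : Tendsto (fun j => lam j ^ 2 / ν) atTop (𝓝 0) := by
    have h := (hlam0.pow 2).div_const ν
    rwa [zero_pow two_ne_zero, zero_div] at h
  have hlarge : ∀ (v : ℕ → EuclideanSpace ℝ (Fin 3)) (z : EuclideanSpace ℝ (Fin 3)), z ≠ 0 →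
      Tendsto (fun j => (lam j ^ 2 / ν) • v j) atTop (𝓝 z) → ∀ᶠ j in atTop, d < ‖v j‖ := by
    intro v z hz hv
    have hzpos : 0 < ‖z‖ := norm_pos_iff.mpr hz
    have h1 : ∀ᶠ j in atTop, ‖z‖ / 2 < ‖(lam j ^ 2 / ν) • v j‖ :=
      (hv.norm).eventually_const_lt (by linarith)
    have h2 : ∀ᶠ j in atTop, lam j ^ 2 / ν < ‖z‖ / (2 * (d + 1)) :=
      hc0.eventually_lt_const (by positivity)
    filter_upwards [h1, h2] with j h1j h2j
    rw [norm_smul, Real.norm_of_nonneg (hcpos j).le] at h1j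
    by_contra hle
    push Not at hle
    have h3 : lam j ^ 2 / ν * ‖v j‖ ≤ ‖z‖ / (2 * (d + 1)) * d :=
      mul_le_mul h2j.le hle (norm_nonneg _) (by positivity)
    have h4 : ‖z‖ / (2 * (d + 1)) * d < ‖z‖ / 2 := by
      rw [div_mul_eq_mul_div, div_lt_div_iff₀ (by positivity) (by positivity)]
      nlinarith
    linarith
  have hea := hlarge a (Ω y) hy hca
  have heb := hlarge b (Ω y') hy' hcb
  -- `t_j → T` from the left, so `θ(t_j) → 0`
  have htW : Tendsto t atTop (𝓝[<] T) :=
    tendsto_nhdsWithin_iff.2 ⟨htT, Eventually.of_forall fun j => (ht j).2⟩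
  have hθt : Tendsto (fun j => θ (t j)) atTop (𝓝 0) := hθ.comp htW
  -- the dominating argument `θ(t_j) K |y − y'|` tends to `0` within `[0, ∞)`
  set L : ℝ := K * ‖y - y'‖ with hL
  have hL0 : 0 ≤ L := by positivity
  have harg : Tendsto (fun j => θ (t j) * L) atTop (𝓝[≥] 0) := by
    refine tendsto_nhdsWithin_iff.2 ⟨?_, Eventually.of_forall fun j => mul_nonneg (hθ0 _) hL0⟩
    have h := hθt.mul_const L
    rwa [zero_mul] at h
  have hηlim : Tendsto (fun j => η (θ (t j) * L)) atTop (𝓝 0) := by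
    have hcont : ContinuousWithinAt η (Ici 0) 0 := hηc 0 (mem_Ici.2 le_rfl)
    have h := hcont.tendsto.comp harg
    rwa [hη0] at h
  -- (CA′) at the two physical points, rewritten in zoom variables and dominated by monotonicity
  have hbound : ∀ᶠ j in atTop, ‖‖a j‖⁻¹ • a j - ‖b j‖⁻¹ • b j‖ ≤ η (θ (t j) * L) := by
    filter_upwards [hea, heb] with j hja hjb
    have hms := hmod (t j) (ht j) (P j) (P' j) hja hjb
    rw [vorticityDirection_apply, vorticityDirection_apply] at hms
    have hdist : ‖P j - P' j‖ = lam j * ‖y - y'‖ := by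
      have e : P j - P' j = lam j • (y - y') := by
        simp only [hP, hP', smul_sub]; abel
      rw [e, norm_smul, Real.norm_of_nonneg (hlam j).le]
    have hsqpos : 0 < Real.sqrt (ν * (T - t j)) :=
      Real.sqrt_pos.2 (mul_pos hν (sub_pos.2 (ht j).2))
    -- the argument of `η` is at most `θ(t_j) L`
    have harg_le : θ (t j) * ‖P j - P' j‖ / Real.sqrt (ν * (T - t j)) ≤ θ (t j) * L := by
      rw [hdist, hL, div_le_iff₀ hsqpos]
      have h1 : lam j * ‖y - y'‖ ≤ K * Real.sqrt (ν * (T - t j)) * ‖y - y'‖ :=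
        mul_le_mul_of_nonneg_right (hrate j) (norm_nonneg _)
      have h2 : θ (t j) * (lam j * ‖y - y'‖) ≤ θ (t j) * (K * Real.sqrt (ν * (T - t j)) * ‖y - y'‖) :=
        mul_le_mul_of_nonneg_left h1 (hθ0 _)
      calc θ (t j) * (lam j * ‖y - y'‖) ≤ θ (t j) * (K * Real.sqrt (ν * (T - t j)) * ‖y - y'‖) := h2
        _ = θ (t j) * (K * ‖y - y'‖) * Real.sqrt (ν * (T - t j)) := by ring
    have harg_nn : 0 ≤ θ (t j) * ‖P j - P' j‖ / Real.sqrt (ν * (T - t j)) := by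
      have := hθ0 (t j)
      positivity
    exact hms.trans (hmono harg_nn (harg_nn.trans harg_le) harg_le)
  -- pass to the limit: the chord of the limit directions is `≤ 0`
  have hle : ‖‖Ω y‖⁻¹ • Ω y - ‖Ω y'‖⁻¹ • Ω y'‖ ≤ 0 :=
    le_of_tendsto_of_tendsto hchord hηlim hbound
  have h0 : ‖‖Ω y‖⁻¹ • Ω y - ‖Ω y'‖⁻¹ • Ω y'‖ = 0 := le_antisymm hle (norm_nonneg _)
  rw [norm_eq_zero, sub_eq_zero] at h0
  have _ := hT
  exact h0

/-- A field whose directions agree wherever it is non-zero has the form `Ω(y) = ‖Ω(y)‖ ζ₀` for ONE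
vector `ζ₀` (a unit vector if `Ω ≢ 0`; for `Ω ≡ 0` any vector serves) — the printed
"`ω(x,t) = |ω(x,t)| ζ₀(t)`" (HUPS #956 p. 7). [cite: GigaMiura2011, Prop. 2.2, proof, first step (§2.1; HUPS preprint #956 p. 7)] -/
theorem exists_eq_norm_smul_of_dir_eq {Ω : EuclideanSpace ℝ (Fin 3) → EuclideanSpace ℝ (Fin 3)}
    (h : ∀ y y', Ω y ≠ 0 → Ω y' ≠ 0 → ‖Ω y‖⁻¹ • Ω y = ‖Ω y'‖⁻¹ • Ω y') :
    ∃ ζ₀ : EuclideanSpace ℝ (Fin 3), ∀ y, Ω y = ‖Ω y‖ • ζ₀ := by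
  by_cases h0 : ∀ y, Ω y = 0
  · exact ⟨0, fun y => by rw [h0 y, norm_zero, zero_smul]⟩
  · push Not at h0
    obtain ⟨y₀, hy₀⟩ := h0
    refine ⟨‖Ω y₀‖⁻¹ • Ω y₀, fun y => ?_⟩
    by_cases hy : Ω y = 0
    · rw [hy, norm_zero, zero_smul]
    · rw [← h y y₀ hy hy₀, smul_smul, mul_inv_cancel₀ (norm_ne_zero_iff.2 hy), one_smul]

end Passage

/-! ### §E. Assembly: Proposition 2.2 as printed -/

section Assembly

/-- Every `t < 0` sits in the inner part `[a + 1/2, a + 1)` of a unit window `(a, a + 1)` with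
`a + 1 < 0`. [folklore] -/
private theorem exists_unit_window {t : ℝ} (ht : t < 0) :
    ∃ a : ℝ, t ∈ Ico (a + 1 / 2) (a + 1) ∧ a + 1 < 0 := by
  refine ⟨min (t - 1 / 2) (t / 2 - 1), ⟨?_, ?_⟩, ?_⟩
  · have : min (t - 1 / 2) (t / 2 - 1) ≤ t - 1 / 2 := min_le_left _ _
    linarith
  · rcases le_total (t - 1 / 2) (t / 2 - 1) with h | h
    · rw [min_eq_left h]; linarith
    · rw [min_eq_right h]; linarith
  · have : min (t - 1 / 2) (t / 2 - 1) ≤ t / 2 - 1 := min_le_right _ _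
    linarith

/-- **A bounded continuous Oseen-mild ancient field is smooth on the open slab with all spatial
derivatives bounded uniformly in time** — the standing bounds (2.1) of Giga–Miura's blow-up limits
("`|∂ₓᵏū| < C_k` in `ℝ³ × (−∞, 0)`", HUPS #956 p. 5), here from KNSS 2009 Prop. 4.1 / (4.10) on unit
windows. [cite: KochNadirashviliSereginSverak2009, Prop. 4.1 with (4.10) (arXiv:0709.3599 p. 8)] -/
theorem smooth_and_bounds_of_bounded_ancient_oseenMild {M : ℝ}
    {W : ℝ → EuclideanSpace ℝ (Fin 3) → EuclideanSpace ℝ (Fin 3)}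
    (hWc : ContinuousOn (uncurry W) (Iio 0 ×ˢ univ))
    (hWdiv : ∀ t < 0, IsWeaklyDivFree (W t))
    (hWmild : ∀ s t : ℝ, s < t → t < 0 → ∀ x,
      W t x = UnboundedOperators.heatExtension (W s) (t - s) x - oseenDuhamel 1 s W W t x)
    (hWbd : ∀ t < 0, ∀ x, ‖W t x‖ ≤ M) :
    ContDiffOn ℝ (⊤ : ℕ∞) (uncurry W) (Iio 0 ×ˢ univ) ∧
      ∀ k : ℕ, ∃ C : ℝ, ∀ t < 0, ∀ x, ‖iteratedFDeriv ℝ k (W t) x‖ ≤ C := by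
  -- `W` restricted to `(A, 0)` for any `A`
  have hres : ∀ A : ℝ, ContinuousOn (uncurry W) (Ioo A 0 ×ˢ univ) ∧
      (∀ τ ∈ Ioo A 0, IsWeaklyDivFree (W τ)) ∧
      (∀ s' t' : ℝ, A < s' → s' < t' → t' < 0 → ∀ y,
        W t' y = UnboundedOperators.heatExtension (W s') (t' - s') y - oseenDuhamel 1 s' W W t' y) ∧
      (∀ τ ∈ Ioo A 0, ∀ y, ‖W τ y‖ ≤ M) := fun A =>
    ⟨hWc.mono (prod_mono Ioo_subset_Iio_self Subset.rfl), fun τ hτ => hWdiv τ hτ.2,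
      fun s' t' _ hst ht' y => hWmild s' t' hst ht' y, fun τ hτ y => hWbd τ hτ.2 y⟩
  refine ⟨?_, fun k => ?_⟩
  · refine contDiffOn_of_locally_contDiffOn ?_
    rintro ⟨t, x⟩ ⟨ht, -⟩
    have ht0 : t < 0 := ht
    obtain ⟨hc, hdiv, hmild, hbd⟩ := hres (t - 1)
    refine ⟨Ioo (t - 1) 0 ×ˢ univ, isOpen_Ioo.prod isOpen_univ,
      ⟨⟨by linarith, ht0⟩, mem_univ _⟩, ?_⟩
    exact (contDiffOn_of_bounded_oseenMild hc hdiv hmild hbd).mono inter_subset_right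
  · obtain ⟨K, hK⟩ := exists_norm_iteratedFDeriv_le_of_bounded_oseenMild M k (ℓ := 1) (δ := 1 / 2)
      one_pos (by norm_num)
    refine ⟨K, fun t ht x => ?_⟩
    obtain ⟨a, htI, ha1⟩ := exists_unit_window ht
    obtain ⟨hc, hdiv, hmild, hbd⟩ := hres (a - 1)
    exact hK (show a - 1 < a by linarith) ha1 hc hdiv hmild hbd t htI x

/-- **Giga–Miura 2011, Proposition 2.2 as printed, PROVED** — discharge of the named fact
`gigaMiura2011_scaledAlignment_blowupLimit_curl_eq_zero` (HUPS #956 p. 7 = CMP 303 §2.1: for a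
solution blowing up at `T` whose vorticity direction obeys (CA′), the vorticity of the blow-up limit
of the near-maximum rescaling vanishes; tree frame: classical solution of viscosity `ν` on
`ℝ³ × [0, T)`, Leray–Hopf from `u 0`, bounded on closed sub-strips, (CA′) =
`HasScaledContinuousAlignment ν T u`, the near-maximum sequence `(t_k, x_k, M_k)` of p. 5, scales
`λ_k = ν/M_k`, and ANY pointwise limit `Ω` on `s ≤ 0` of the rescaled vorticities). Proof, following
§2.1 of the paper (module docstring): the zooms `u_k` are unit-viscosity Oseen-mild fields bounded by
`2` on the windows `(−t_kM_k²/ν, 2B)` (Leray's (3.15) after `t_k`; `B > 0` universal by Leray's rate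
at the near-maximum points), so by KNSS Lemma 6.1 (`KNSS2009_lemma61_oseenMild`, applied after the
time shift `s ↦ s + B`) a subsequence converges locally uniformly, with its gradients
(`tendsto_curl_of_bounded_oseenMild`), to a bounded ancient mild field `ū`; (CA′) forces
`curl ū(s) = |curl ū(s)| ζ₀(s)` (`dir_eq_of_scaledAlignment_lerayZoom`), the rigidity part of
Prop. 2.2 (`gigaMiura2011_unidirectional_vorticity_eq_zero_holds`: 2D reduction + Lemma 2.3 /
[KNSS]) gives `curl ū ≡ 0`, and `Ω`, the limit along the whole sequence, coincides with `curl ū`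
along the subsequence, hence vanishes on `s ≤ 0`. [cite: GigaMiura2011, Prop. 2.2 (§2.1; HUPS preprint #956 p. 7, blow-up sequence p. 5, proof pp. 7–8)] -/
theorem gigaMiura2011_scaledAlignment_blowupLimit_curl_eq_zero_holds :
    gigaMiura2011_scaledAlignment_blowupLimit_curl_eq_zero := by
  intro ν T hν hT u p hsol hLH hslab hCA tk xk M htk htkT hMpos hMlim hMbd hnear Ω hΩ
  -- ### constants: Leray's rate `c`, Leray's window constant `C₁`
  obtain ⟨c, hc, hLer⟩ := exists_lerayRate_point_of_unbounded
  obtain ⟨C₁, hC₁, hapr⟩ := exists_norm_le_two_mul_after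
  have hbdd : ∀ T₁ ∈ Ioo 0 T, ∃ B : ℝ, ∀ t ∈ Icc 0 T₁, ∀ x, ‖u t x‖ ≤ B := fun T₁ hT₁ =>
    hslab T₁ hT₁.2
  -- `u` is unbounded on `[0, T) × ℝ³` (the near-maximum sequence)
  have hunb : ¬ ∃ B : ℝ, ∀ t ∈ Ico 0 T, ∀ x, ‖u t x‖ ≤ B := by
    rintro ⟨B, hB⟩
    have h1 : ∀ k, M k ≤ B + 1 := fun k => by
      have := (hnear k).trans (hB (tk k) (Ioo_subset_Ico_self (htk k)) (xk k))
      linarith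
    have h2 : ∀ᶠ k in atTop, B + 2 ≤ M k := hMlim.eventually (eventually_ge_atTop (B + 2))
    obtain ⟨k, hk⟩ := h2.exists
    linarith [h1 k]
  -- Leray's rate at the near-maximum levels: `c²ν ≤ M_k² (T − t_k)`
  have hrateM : ∀ k, c ^ 2 * ν ≤ M k ^ 2 * (T - tk k) := fun k => by
    obtain ⟨x, hx⟩ := hLer hν hT hsol hLH hbdd hunb (tk k) (Ioo_subset_Ico_self (htk k))
    have hMx : ‖u (tk k) x‖ ≤ M k := hMbd k (tk k) ⟨(htk k).1.le, le_rfl⟩ x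
    have hsq : 0 < Real.sqrt (T - tk k) := Real.sqrt_pos.2 (sub_pos.2 (htk k).2)
    have h1 : c * Real.sqrt ν ≤ M k * Real.sqrt (T - tk k) := by
      rw [← div_le_iff₀ hsq]; exact hx.trans hMx
    have h2 : (c * Real.sqrt ν) ^ 2 ≤ (M k * Real.sqrt (T - tk k)) ^ 2 :=
      pow_le_pow_left₀ (by positivity) h1 2
    rw [mul_pow, mul_pow, Real.sq_sqrt hν.le, Real.sq_sqrt (sub_pos.2 (htk k).2).le] at h2
    exact h2
  -- ### the scales `λ_k = ν/M_k`, the window ends `A_k = −t_kM_k²/ν`, `B'_k = (T−t_k)M_k²/ν ≥ c²`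
  set lam : ℕ → ℝ := fun k => ν / M k with hlamdef
  have hlam : ∀ k, 0 < lam k := fun k => div_pos hν (hMpos k)
  have hM0 : ∀ k, M k ≠ 0 := fun k => (hMpos k).ne'
  have hlamM : ∀ k, lam k / ν * M k = 1 := fun k => by
    simp only [hlamdef]; field_simp [hM0 k]
  have hlam2 : ∀ k, lam k ^ 2 / ν = ν / M k ^ 2 := fun k => by
    simp only [hlamdef]; field_simp
  have hlam0 : Tendsto lam atTop (𝓝 0) := tendsto_const_nhds.div_atTop hMlim
  set A : ℕ → ℝ := fun k => -(tk k * ν / lam k ^ 2) with hAdef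
  set B' : ℕ → ℝ := fun k => (T - tk k) * ν / lam k ^ 2 with hB'def
  have hB'eq : ∀ k, B' k = (T - tk k) * M k ^ 2 / ν := fun k => by
    simp only [hB'def, hlamdef]
    field_simp
  have hB'c : ∀ k, c ^ 2 ≤ B' k := fun k => by
    rw [hB'eq, le_div_iff₀ hν]
    linarith [hrateM k]
  -- the universal window length beyond the centre
  set B : ℝ := min (c ^ 2 / 4) (1 / (128 * C₁ ^ 2)) with hBdef
  have hBpos : 0 < B := lt_min (by positivity) (by positivity)
  have hBc : B ≤ c ^ 2 / 4 := min_le_left _ _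
  have hBC : B ≤ 1 / (128 * C₁ ^ 2) := min_le_right _ _
  have hc2 : 0 < c ^ 2 := pow_pos hc 2
  have h2BB' : ∀ k, 2 * B < B' k := fun k => by linarith [hB'c k, hBc, hc2]
  -- ### the zooms and their bound `2` on `(A_k, 2B)`
  set w : ℕ → ℝ → EuclideanSpace ℝ (Fin 3) → EuclideanSpace ℝ (Fin 3) :=
    fun k => (lam k / ν) • stPull (lam k ^ 2 / ν) (lam k) (tk k) (xk k) u with hwdef
  have hwcl : ∀ k, IsClassicalNSSolutionOn (Ioo (A k) (B' k)) 1 0 (w k)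
      ((lam k / ν) ^ 2 • stPull (lam k ^ 2 / ν) (lam k) (tk k) (xk k) p) := fun k =>
    zoom_isClassical_window (t₀ := tk k) (x₀ := xk k) hν hsol (hlam k)
  have hwbd : ∀ k, ∀ s ∈ Ioo (A k) (2 * B), ∀ y, ‖w k s y‖ ≤ 2 := by
    intro k s hs y
    have hsI : s ∈ Ioo (A k) (B' k) := ⟨hs.1, hs.2.trans (h2BB' k)⟩
    have hτ := zoom_time_mem' (T := T) (t₀ := tk k) hν (hlam k) hsI
    rcases le_or_gt s 0 with hs0 | hs0
    · -- physical time `≤ t_k`: the level `M_k` bounds `u`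
      have hτle : tk k + lam k ^ 2 / ν * s ≤ tk k := by
        have : lam k ^ 2 / ν * s ≤ 0 :=
          mul_nonpos_of_nonneg_of_nonpos (div_pos (pow_pos (hlam k) 2) hν).le hs0
        linarith
      have hK : ∀ x, ‖u (tk k + lam k ^ 2 / ν * s) x‖ ≤ M k := fun x =>
        hMbd k _ ⟨hτ.1.le, hτle⟩ x
      calc ‖w k s y‖ ≤ lam k / ν * M k := norm_zoom_le hν (hlam k) hK y
        _ = 1 := hlamM k
        _ ≤ 2 := by norm_num
    · -- physical time in `(t_k, T)`: Leray's (3.15) after `t_k` bounds `u` by `2M_k`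
      have hu₀ : ∀ x, ‖u (tk k) x‖ ≤ M k := fun x => hMbd k _ ⟨(htk k).1.le, le_rfl⟩ x
      have hwin : 64 * C₁ ^ 2 * M k ^ 2 * (tk k + lam k ^ 2 / ν * s - tk k) < ν := by
        rw [add_sub_cancel_left, hlam2 k]
        have hM2 : 0 < M k ^ 2 := pow_pos (hMpos k) 2
        have e : 64 * C₁ ^ 2 * M k ^ 2 * (ν / M k ^ 2 * s) = ν * (64 * C₁ ^ 2 * s) := by
          field_simp [hM0 k]
        rw [e]
        have hs1 : 64 * C₁ ^ 2 * s < 1 := by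
          have h1 : s < 1 / (64 * C₁ ^ 2) := by
            have : 2 * B ≤ 2 * (1 / (128 * C₁ ^ 2)) := by linarith
            have e2 : 2 * (1 / (128 * C₁ ^ 2)) = 1 / (64 * C₁ ^ 2) := by
              field_simp; ring
            linarith [hs.2]
          have h64 : 0 < 64 * C₁ ^ 2 := by positivity
          calc 64 * C₁ ^ 2 * s < 64 * C₁ ^ 2 * (1 / (64 * C₁ ^ 2)) := mul_lt_mul_of_pos_left h1 h64
            _ = 1 := by field_simp
        calc ν * (64 * C₁ ^ 2 * s) < ν * 1 := mul_lt_mul_of_pos_left hs1 hν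
          _ = ν := mul_one ν
      have hτI : tk k + lam k ^ 2 / ν * s ∈ Ico (tk k) T :=
        ⟨by linarith [mul_pos (div_pos (pow_pos (hlam k) 2) hν) hs0], hτ.2⟩
      have hK : ∀ x, ‖u (tk k + lam k ^ 2 / ν * s) x‖ ≤ 2 * M k := fun x =>
        hapr hν hT hsol hLH hbdd (Ioo_subset_Ico_self (htk k)) (hMpos k) hu₀ _ hτI hwin x
      calc ‖w k s y‖ ≤ lam k / ν * (2 * M k) := norm_zoom_le hν (hlam k) hK y
        _ = 2 := by rw [mul_left_comm, hlamM k, mul_one]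
  -- ### the shifted zooms `s ↦ w_k(s + B)` on `(A_k − B, 0)`
  set ws : ℕ → ℝ → EuclideanSpace ℝ (Fin 3) → EuclideanSpace ℝ (Fin 3) :=
    fun k s y => w k (s + B) y with hwsdef
  set As : ℕ → ℝ := fun k => A k - B with hAsdef
  have hshift : ∀ k, ∀ s ∈ Ioo (As k) 0, s + B ∈ Ioo (A k) (B' k) := fun k s hs =>
    ⟨by simp only [hAsdef] at hs; linarith [hs.1], by linarith [hs.2, h2BB' k]⟩
  have hshift2 : ∀ k, ∀ s ∈ Ioo (As k) 0, s + B ∈ Ioo (A k) (2 * B) := fun k s hs =>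
    ⟨by simp only [hAsdef] at hs; linarith [hs.1], by linarith [hs.2]⟩
  have hAs : Tendsto As atTop atBot := by
    have h1 : Tendsto (fun k => tk k * (M k ^ 2 / ν)) atTop atTop :=
      htkT.pos_mul_atTop hT (((tendsto_pow_atTop two_ne_zero).comp hMlim).atTop_div_const hν)
    have h2 : Tendsto (fun k => -(tk k * (M k ^ 2 / ν)) + -B) atTop atBot :=
      tendsto_atBot_add_const_right _ _ (tendsto_neg_atTop_atBot.comp h1)
    refine h2.congr fun k => ?_
    simp only [hAsdef, hAdef, hlamdef]
    field_simp
    ring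
  have hwsc : ∀ k, ContinuousOn (uncurry (ws k)) (Ioo (As k) 0 ×ˢ univ) := by
    intro k
    have hmap : Continuous fun q : ℝ × EuclideanSpace ℝ (Fin 3) => (q.1 + B, q.2) :=
      (continuous_fst.add continuous_const).prodMk continuous_snd
    have hinto : MapsTo (fun q : ℝ × EuclideanSpace ℝ (Fin 3) => (q.1 + B, q.2))
        (Ioo (As k) 0 ×ˢ univ) (Ioo (A k) (B' k) ×ˢ univ) := fun q hq =>
      ⟨hshift k q.1 hq.1, mem_univ _⟩
    exact ((hwcl k).smooth_velocity.continuousOn.comp hmap.continuousOn hinto).congr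
      fun q _ => rfl
  have hwsdiv : ∀ k, ∀ s ∈ Ioo (As k) 0, IsWeaklyDivFree (ws k s) := fun k s hs =>
    zoom_isWeaklyDivFree_window (t₀ := tk k) (x₀ := xk k) hν hsol (hlam k) (hshift k s hs)
  have hwsmild : ∀ k, ∀ s t : ℝ, As k < s → s < t → t < 0 → ∀ x,
      ws k t x = UnboundedOperators.heatExtension (ws k s) (t - s) x -
        oseenDuhamel 1 s (ws k) (ws k) t x := by
    intro k s t hs hst ht x
    have hsI := hshift k s ⟨hs, hst.trans ht⟩
    have htI := hshift k t ⟨hs.trans hst, ht⟩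
    have h := zoom_oseen_window (t₀ := tk k) (x₀ := xk k) hν hT hsol hLH hbdd (hlam k) hsI.1
      (show s + B < t + B by linarith) htI.2 x
    show w k (t + B) x = UnboundedOperators.heatExtension (w k (s + B)) (t - s) x -
      oseenDuhamel 1 s (fun τ => w k (τ + B)) (fun τ => w k (τ + B)) t x
    rw [oseenDuhamel_translate]
    rw [show t + B - (s + B) = t - s by ring] at h
    exact h
  have hwsbd : ∀ k, ∀ s ∈ Ioo (As k) 0, ∀ y, ‖ws k s y‖ ≤ 2 := fun k s hs y =>
    hwbd k (s + B) (hshift2 k s hs) y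
  -- ### KNSS Lemma 6.1: a locally uniformly convergent subsequence and its bounded ancient limit
  obtain ⟨φ, W, hφ, hWc, hWdiv, hWbd, hWmild, -, hpt, -⟩ :=
    KNSS2009_lemma61_oseenMild hAs hwsc hwsdiv hwsmild hwsbd
  have hφt : Tendsto φ atTop atTop := hφ.tendsto_atTop
  -- the vorticities converge along the subsequence, at every `s < 0`
  have hcurl : ∀ s < 0, ∀ y, Tendsto (fun j => curl (ws (φ j) s) y) atTop (𝓝 (curl (W s) y)) :=
    fun s hs y =>
    tendsto_curl_of_bounded_oseenMild (hAs.comp hφt) (fun j => hwsc (φ j)) (fun j => hwsdiv (φ j))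
      (fun j => hwsmild (φ j)) (fun j => hwsbd (φ j)) hWc hWdiv hWmild hWbd
      (fun t ht x => (hpt t ht x)) hs y
  -- the vorticity of the shifted zoom in physical variables
  have hcurlw : ∀ k s y, curl (ws k s) y =
      (lam k ^ 2 / ν) • curl (u (tk k + lam k ^ 2 / ν * (s + B))) (xk k + lam k • y) :=
    fun k s y => curl_zoom (s + B) y
  -- ### (CA′) along the zoom: the limit vorticity has a time-only direction
  have hdir : ∀ s < 0, ∃ ζ : EuclideanSpace ℝ (Fin 3), ∀ y, curl (W s) y = ‖curl (W s) y‖ • ζ := by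
    intro s hs
    -- physical times of the slice `s + B` of the zooms
    set τ : ℕ → ℝ := fun k => tk k + lam k ^ 2 / ν * (s + B) with hτdef
    -- eventually the slice lies in the window
    obtain ⟨j₀, hj₀⟩ : ∃ j₀ : ℕ, ∀ j, j₀ ≤ j → As (φ j) < s := by
      have h := (hAs.comp hφt).eventually (eventually_lt_atBot s)
      obtain ⟨j₀, hj₀⟩ := h.exists_forall_of_atTop
      exact ⟨j₀, hj₀⟩
    set κ : ℕ → ℕ := fun j => φ (j + j₀) with hκdef
    have hκs : ∀ j, s ∈ Ioo (As (κ j)) 0 := fun j => ⟨hj₀ _ (Nat.le_add_left j₀ j), hs⟩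
    have hτI : ∀ j, τ (κ j) ∈ Ioo 0 T := fun j =>
      zoom_time_mem' (T := T) (t₀ := tk (κ j)) hν (hlam _) (hshift _ s (hκs j))
    have hκt : Tendsto κ atTop atTop := hφt.comp (tendsto_add_atTop_nat j₀)
    have hτT : Tendsto (fun j => τ (κ j)) atTop (𝓝 T) := by
      have h1 : Tendsto (fun j => lam (κ j) ^ 2 / ν * (s + B)) atTop (𝓝 (0 ^ 2 / ν * (s + B))) :=
        (((hlam0.comp hκt).pow 2).div_const ν).mul_const _
      rw [zero_pow two_ne_zero, zero_div, zero_mul] at h1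
      have h2 := (htkT.comp hκt).add h1
      rw [add_zero] at h2
      exact h2
    -- Leray's rate in the form `λ ≤ (√2/c) √(ν(T − τ))`
    have hrate : ∀ j, lam (κ j) ≤ Real.sqrt 2 / c * Real.sqrt (ν * (T - τ (κ j))) := by
      intro j
      set k := κ j with hk
      have hM2 : 0 < M k ^ 2 := pow_pos (hMpos k) 2
      -- `ν (s + B)/M_k² ≤ (T − t_k)/2`
      have hhalf : lam k ^ 2 / ν * (s + B) ≤ (T - tk k) / 2 := by
        rw [hlam2 k]
        have h1 : ν / M k ^ 2 * (s + B) ≤ ν / M k ^ 2 * B :=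
          mul_le_mul_of_nonneg_left (by linarith) (div_pos hν hM2).le
        have h2 : ν / M k ^ 2 * B ≤ (T - tk k) / 2 := by
          rw [div_mul_eq_mul_div, div_le_iff₀ hM2]
          nlinarith [hrateM k, hBc]
        exact h1.trans h2
      have hTτ : (T - tk k) / 2 ≤ T - τ k := by
        simp only [hτdef]; linarith
      have hsq : lam k ^ 2 ≤ (Real.sqrt 2 / c * Real.sqrt (ν * (T - τ k))) ^ 2 := by
        have e : (Real.sqrt 2 / c * Real.sqrt (ν * (T - τ k))) ^ 2 = 2 / c ^ 2 * (ν * (T - τ k)) := by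
          rw [mul_pow, div_pow (Real.sqrt 2) c 2, Real.sq_sqrt (by norm_num : (0:ℝ) ≤ 2),
            Real.sq_sqrt (mul_nonneg hν.le (by linarith [sub_pos.2 (htk k).2]))]
        rw [e]
        have h1 : lam k ^ 2 ≤ ν * (T - tk k) / c ^ 2 := by
          rw [le_div_iff₀ (pow_pos hc 2), show lam k ^ 2 = ν * (lam k ^ 2 / ν) by field_simp,
            hlam2 k]
          rw [show ν * (ν / M k ^ 2) * c ^ 2 = ν * (c ^ 2 * ν) / M k ^ 2 by field_simp,
            div_le_iff₀ hM2]
          nlinarith [hrateM k, hν]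
        have h2 : ν * (T - tk k) / c ^ 2 ≤ 2 / c ^ 2 * (ν * (T - τ k)) := by
          rw [div_mul_eq_mul_div, div_le_div_iff_of_pos_right (pow_pos hc 2)]
          nlinarith [hTτ, hν]
        exact h1.trans h2
      exact (pow_le_pow_iff_left₀ (hlam k).le (by positivity) two_ne_zero).1 hsq
    have hconv : ∀ y, Tendsto (fun j => (lam (κ j) ^ 2 / ν) • curl (u (τ (κ j)))
        (xk (κ j) + lam (κ j) • y)) atTop (𝓝 (curl (W s) y)) := by
      intro y
      have h := (hcurl s hs y).comp (tendsto_add_atTop_nat j₀)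
      refine h.congr fun j => ?_
      simp only [comp_apply, hcurlw]
      rfl
    exact exists_eq_norm_smul_of_dir_eq
      (dir_eq_of_scaledAlignment_lerayZoom hT hCA hτI hτT (fun j => hlam _) (hlam0.comp hκt)
        (by positivity) hrate hconv hν)
  choose! ζ₀ hζ₀ using hdir
  -- ### the rigidity half of Proposition 2.2: the limit has zero vorticity
  obtain ⟨hWsm, hWD⟩ := smooth_and_bounds_of_bounded_ancient_oseenMild hWc hWdiv hWmild hWbd
  have hW0 : ∀ t < 0, ∀ x, curl (W t) x = 0 :=
    gigaMiura2011_unidirectional_vorticity_eq_zero_holds hWsm hWD hWdiv hWmild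
      ⟨ζ₀, fun t ht x => hζ₀ t ht x⟩
  -- ### conclusion: `Ω(s, ·) = curl ū(s − B, ·) = 0` for `s ≤ 0`
  intro s hs y
  have hsB : s - B < 0 := by linarith
  -- the hypothesis, rewritten as the vorticity of the shifted zooms at time `s − B`
  have hfull : Tendsto (fun k => curl (ws k (s - B)) y) atTop (𝓝 (Ω s y)) := by
    refine (hΩ s hs y).congr fun k => ?_
    rw [hcurlw k (s - B) y, sub_add_cancel, hlam2 k]
    simp only [hlamdef]
    have e2 : tk k + (ν / M k) ^ 2 * s / ν = tk k + ν / M k ^ 2 * s := by field_simp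
    rw [e2]
  have hsub : Tendsto (fun j => curl (ws (φ j) (s - B)) y) atTop (𝓝 (Ω s y)) := hfull.comp hφt
  have hlim : Tendsto (fun j => curl (ws (φ j) (s - B)) y) atTop (𝓝 (curl (W (s - B)) y)) :=
    hcurl (s - B) hsB y
  rw [tendsto_nhds_unique hsub hlim]
  exact hW0 (s - B) hsB y

end Assembly




end Literature.Analysis.FluidPDE

end
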